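import Literature.NumberTheory.LFunctions.LargeValuesS2GeneralK
import HarnessLib

/-!
# Jutila 1977, proof of the large values theorem (1.4): the pair-correlation sum (kernel, part B)

NOT RH-BEARING (D-0040; bears_on LADDER-RH §4 HELD `DensityLadder`): a large-values / zero-density
result counts zeros off the critical line, it never empties the strip
(`Literature.Barriers.RiemannHypothesis.LindelofBacklund`); nothing in this file bears on the truth of RH.

Topic `NumberTheory/LFunctions`. M. Jutila, *Zero-density estimates for `L`-functions*, Acta Arith.
32 (1977) 55–62, §3 "Proof of the theorem", displays (3.1)–(3.2) and the display after (3.2), in the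
case `q = 1` (estimate (1.2), from which (1.4) follows by Huxley's subdivision). After the
Halász–Montgomery inequality (3.1), `R²V² ≪ GRN + G ∑_{r≠s} |H(s_r + s̄_s)|`, Jutila bounds the
correlation `H` of the smoothed coefficient sequence by a short Dirichlet polynomial of length
`M ≍ T₀/N` (his Lemma 1, the reflection principle), applies Hölder's inequality with exponent `2k` over
the pairs (3.2), rewrites the `k`-th power as one Dirichlet polynomial with `d_k`-bounded coefficients
and bounds its mean square over the difference set.

This file proves the resulting bound for the OFF-DIAGONAL PAIR SUM in the setting of the tree's
Guth–Maynard apparatus (points `it` on the imaginary axis, the smooth weight `w` of Guth–Maynard §3 in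
place of Jutila's `e^{-(n/N)^h}` weights): with `B_N = GuthMaynardFourier.coefB w N` (the non-zero
frequencies of the Poisson formula for `∑_n w(n/N)² n^{iτ}`, Guth–Maynard Lemma 4.5),

`N ∑_{t≠t'∈W} |B_N(t−t')| ≤ C T^ε ( |W| + N^{1/2} |W|^{2−1/k} ( |W| ((T/N)^k + (|W|T)^{1/2}) )^{1/(2k)} )`

for `1`-separated `W` with pairwise differences `≤ T`, `1 ≤ T ≤ N^A`, `N ≥ N₀(k, A, ε, w)` — exactly the
bracket of the display after (3.2) on p. 60 of Jutila (`GRN + GN^{1/2}(qT)^ε R^{2−1/k}{R((qT/N)^k +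
(RTq)^{1/2})}^{1/2k}` at `q = 1`, the factor `G` being supplied by the Halász–Montgomery step).

## The road (Jutila §3 with two tree substitutions)

* Jutila's Lemma 1 (reflection principle for `H`) ↦ Guth–Maynard's Lemma 6.2 for `B_N`, PROVED in the
  tree: `GuthMaynardS2.norm_coefB_le_main_add` (`|B_N(τ)| ≤ C K|τ|^{-1/2}∫|H_w(ξ)||D_M(τ+2πξ)|dξ +`
  negligible, `M ≍ N^η|τ|/N`), and Lemma 4.3 (`GuthMaynardFourier.norm_coefB_le`) for `|τ| ≤ N^{1−η}`.
* Jutila's Lemma 3, (2.2) (the discrete mean square `≪ (N + (RT)^{1/2}) log^B` from the fourth moment of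
  `ζ`) ↦ HEATH-BROWN's theorem (`HeathBrownDZS.heathBrown_differenceSet`, tree) through the general-`k`
  layer `GuthMaynardS2K.sum_norm_pow_sq_le_dps` / `card_tuples_prod_eq_le` (the `k`-th power as one
  Dirichlet polynomial, fibres `≤ d(g)^k`): for `1`-separated points with differences `≤ T`,
  `∑_{t,t'}|∑_{n∼L} c_n n^{iθ_{tt'}}|² ≪ T^ε (|W|²L + |W|L² + |W|^{5/4}T^{1/2}L)`, and
  `|W|²L ≤ |W|L(2|W|T)^{1/2}`, `|W|^{5/4} ≤ |W|^{3/2}` (`|W| ≤ T + 1 ≤ 2T`), so Heath-Brown's bound is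
  dominated term by term by Jutila's `R M^k (M^k + (RT)^{1/2})` — (2.2) is not needed.
* `moment_dirD_le` — the `2k`-th moment `∑_{t,t'}|D_M(t−t'+2πξ)|^{2k}` (uniformly in the twist `ξ`).
* `sum_class_le` — one dyadic class `T₀ ≤ |t−t'| ≤ 2T₀` (Hölder with exponent `2k` over the pairs of
  the class = (3.2), the moment bound, the domination above, `M ≤ 3N^ηT₀/N`).
* `sum_norm_coefB_pairs_le` — the decomposition of the pairs (`GuthMaynardS2.sum_pairs_le_classes`)
  and the bookkeeping of the `T^ε`-losses.

No definition and no named fact is introduced; everything in this file is proved.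

## References

* M. Jutila, *Zero-density estimates for `L`-functions*, Acta Arith. 32 (1977), 55–62: §2 Lemmas 1–3,
  §3 (3.1), (3.2) and the following display (p. 60). [key `Jutila1977`]
* L. Guth, J. Maynard, *New large value estimates for Dirichlet polynomials*, Ann. of Math. (2) 203
  (2026) = arXiv:2405.20552: Lemma 4.3, Lemma 4.5, Lemma 6.2, §6 (6.3)–(6.4). [key `GuthMaynard2026`]
* D. R. Heath-Brown, *A large values estimate for Dirichlet polynomials*, J. London Math. Soc. (2) 20
  (1979), 8–18 (the tree's `HeathBrownDZS.heathBrown_differenceSet`).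
-/

noncomputable section

open Real Complex Finset MeasureTheory
open scoped ContDiff

namespace Literature.NumberTheory.LFunctions

namespace Jutila1977

open DoubleZetaSums GuthMaynardS2 GuthMaynardFourier GuthMaynardS2K

/-! ## §1. Hölder's inequality over a finite family (Jutila (3.2)) -/

/-- Power mean: `∑_{i∈s} x_i ≤ ((#s)^{q−1} ∑_{i∈s} x_i^q)^{1/q}` for `x ≥ 0` and `q ≥ 1`. [folklore] -/
private theorem pairB_sum_le_rpow_card_pow_mul_sum_pow {ι : Type*} (s : Finset ι) {x : ι → ℝ}
    (hx : ∀ i ∈ s, 0 ≤ x i) {q : ℕ} (hq : 1 ≤ q) :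
    ∑ i ∈ s, x i ≤ ((s.card : ℝ) ^ (q - 1) * ∑ i ∈ s, x i ^ q) ^ (1 / (q : ℝ)) := by
  obtain ⟨n, rfl⟩ : ∃ n, q = n + 1 := ⟨q - 1, by omega⟩
  have h := pow_sum_le_card_mul_sum_pow hx n
  have hS0 : 0 ≤ ∑ i ∈ s, x i := Finset.sum_nonneg hx
  calc ∑ i ∈ s, x i = ((∑ i ∈ s, x i) ^ (n + 1)) ^ (1 / ((n + 1 : ℕ) : ℝ)) := by
        rw [one_div, Real.pow_rpow_inv_natCast hS0 (by omega)]
    _ ≤ ((s.card : ℝ) ^ (n + 1 - 1) * ∑ i ∈ s, x i ^ (n + 1)) ^ (1 / ((n + 1 : ℕ) : ℝ)) := by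
        refine Real.rpow_le_rpow (by positivity) ?_ (by positivity)
        simpa using h

/-! ## §2. The `2k`-th moment of `D_M` over the difference set (Heath-Brown in place of Jutila's (2.2)) -/

/-- An element `m` of `(A, B]` with `⌊log₂(m−1)⌋ = i` satisfies `2^i < m ≤ 2^{i+1}`. [folklore] -/
private theorem pairB_mem_dyadic_piece {A B i m : ℕ} (hm : m ∈ (Finset.Ioc A B).filter (fun m ↦ Nat.log 2 (m - 1) = i))
    (hA : 1 ≤ A) : 2 ^ i < m ∧ m ≤ 2 ^ (i + 1) := by
  rw [Finset.mem_filter, Finset.mem_Ioc] at hm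
  obtain ⟨⟨hAm, -⟩, hi⟩ := hm
  have hm1 : m - 1 ≠ 0 := by omega
  have h1 : 2 ^ i ≤ m - 1 := by rw [← hi]; exact Nat.pow_log_le_self 2 hm1
  have h2 : m - 1 < 2 ^ (i + 1) := by rw [← hi]; exact Nat.lt_pow_succ_log_self one_lt_two _
  omega

set_option maxHeartbeats 1600000 in
/-- **The `2k`-th moment of `D_M(· + 2πξ)` over the difference set.** For `k ≥ 1` and `η > 0` there are
`C, T₀` such that for `T ≥ T₀`, `1 ≤ M ≤ T²`, every `1`-separated `W` in an interval of length `T` and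
every real `ξ`,
`∑_{t,t'∈W} |D_M(t−t'+2πξ)|^{2k} ≤ C T^η (|W|²M^k + |W|M^{2k} + |W|^{5/4}T^{1/2}M^k)`:
the `k`-th power of `D_M(·+2πξ)` is one Dirichlet polynomial on `[1, M^k]` with coefficients bounded
by the representation numbers `≤ d(g)^k ≪ M^{o(1)}` (`GuthMaynardS2K.sum_norm_pow_sq_le_dps`,
`card_tuples_prod_eq_le`, the divisor bound), whose mean square over the difference set is bounded on
each dyadic block by Heath-Brown's theorem (`HeathBrownDZS.heathBrown_differenceSet`). This replaces
Jutila's use of his Lemma 3, eq. (2.2), after his (3.2) ("further, by Lemmas 2 and 3, this implies …").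
[cite: Jutila1977, Section 3 display after (3.2)] -/
theorem moment_dirD_le {k : ℕ} (hk : 1 ≤ k) {η : ℝ} (hη : 0 < η) :
    ∃ C T₀ : ℝ, 0 ≤ C ∧ ∀ (T : ℝ), T₀ ≤ T → ∀ (M : ℕ), 1 ≤ M → (M : ℝ) ≤ T ^ 2 →
      ∀ (W : Finset ℝ) (T₁ : ℝ), (∀ t ∈ W, T₁ ≤ t ∧ t ≤ T₁ + T) →
      (∀ t ∈ W, ∀ t' ∈ W, t ≠ t' → 1 ≤ |t - t'|) → ∀ ξ : ℝ,
      ∑ t ∈ W, ∑ t' ∈ W, ‖dirD M (t - t' + 2 * π * ξ)‖ ^ (2 * k) ≤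
        C * T ^ η * ((W.card : ℝ) ^ 2 * (M : ℝ) ^ k + (W.card : ℝ) * (M : ℝ) ^ (2 * k) +
          (W.card : ℝ) ^ (5 / 4 : ℝ) * T ^ (1 / 2 : ℝ) * (M : ℝ) ^ k) := by
  classical
  have hk0 : (0 : ℝ) < k := by exact_mod_cast hk
  have hkpos : 0 < k := hk
  -- parameters: `η₁` for the divisor bound, `η₃` for the number of dyadic blocks, `η/2` for Heath-Brown
  set η₁ : ℝ := η / (16 * (k : ℝ) ^ 2) with hη₁
  have hη₁0 : 0 < η₁ := by positivity
  set η₃ : ℝ := η / (16 * (k : ℝ)) with hη₃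
  have hη₃0 : 0 < η₃ := by positivity
  obtain ⟨Cd, hCd1, hCd⟩ := Literature.NumberTheory.Sieve.exists_card_divisors_le_mul_rpow' hη₁0
  have hCd0 : 0 ≤ Cd := by linarith
  obtain ⟨T₀, hT₀⟩ := HeathBrownDZS.heathBrown_differenceSet (half_pos hη)
  set Cη : ℝ := 1 / (η₃ * Real.log 2) + 1 with hCη
  have hCη0 : 0 ≤ Cη := by positivity
  refine ⟨6 * (Cd ^ k) ^ 2 * Cη ^ 2, max T₀ 1, by positivity, fun T hT M hM hMT W T₁ hwin hsep ξ ↦ ?_⟩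
  have hTT₀ : T₀ ≤ T := le_trans (le_max_left _ _) hT
  have hT1 : (1 : ℝ) ≤ T := le_trans (le_max_right _ _) hT
  have hT0 : 0 < T := by linarith
  have hM0 : (0 : ℝ) < M := by exact_mod_cast hM
  have hM1 : (1 : ℝ) ≤ M := by exact_mod_cast hM
  set R : ℝ := (W.card : ℝ) with hR
  have hR0 : 0 ≤ R := Nat.cast_nonneg _
  set X : ℝ := R ^ 2 * (M : ℝ) ^ k + R * (M : ℝ) ^ (2 * k) + R ^ (5 / 4 : ℝ) * T ^ (1 / 2 : ℝ) * (M : ℝ) ^ k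
    with hX
  have hX0 : 0 ≤ X := by positivity
  -- Heath-Brown for this `W`, coefficients `1`
  have hCh : ∀ (L : ℕ), 1 ≤ L → dps W (Finset.Ioc L (2 * L)) (fun _ ↦ (1 : ℂ)) ≤
      2 * T ^ (η / 2) * (R ^ 2 * L + R * (L : ℝ) ^ 2 + R ^ (5 / 4 : ℝ) * T ^ (1 / 2 : ℝ) * L) := by
    intro L hL
    exact hT₀ T hTT₀ W T₁ hwin hsep L hL (fun _ ↦ (1 : ℂ)) (fun _ ↦ by simp)
  -- Step 1: the moment is `∑_{t,t'} |P(t−t')^k|²` for the unimodular polynomial `P` on `[1, M]`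
  set F : Finset ℕ := Finset.Icc 1 M with hF
  set a : ℕ → ℂ := fun m ↦ ePow (-(((2 * π * ξ : ℝ) : ℂ) * I)) m with ha
  have ha1 : ∀ m ∈ F, ‖a m‖ ≤ 1 := by
    intro m hm
    rw [hF, Finset.mem_Icc] at hm
    exact (norm_ePow_coeff hm.1 ξ).le
  set Y : ℝ := ∑ t ∈ W, ∑ t' ∈ W, ‖(∑ n ∈ F, a n * twist n (t - t')) ^ k‖ ^ 2 with hY
  have hLHS : ∑ t ∈ W, ∑ t' ∈ W, ‖dirD M (t - t' + 2 * π * ξ)‖ ^ (2 * k) = Y := by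
    rw [hY, Finset.sum_comm]
    refine Finset.sum_congr rfl fun t' _ ↦ Finset.sum_congr rfl fun t _ ↦ ?_
    rw [dirD_sub_add, norm_pow, ← pow_mul, mul_comm k 2]
    rfl
  rw [hLHS]
  -- Step 2: the `k`-th power lives on `G = [1, M^k]`, fibres `≤ d(g)^k ≤ (Cd (M^k)^{η₁})^k`
  set G : Finset ℕ := Finset.Icc 1 (M ^ k) with hG
  have hG0 : 0 ∉ G := by simp [hG]
  have hMk1 : 1 ≤ M ^ k := Nat.one_le_pow _ _ hM
  have hFG : ∀ f ∈ Fintype.piFinset (fun _ : Fin k ↦ F), (∏ i, f i) ∈ G := by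
    intro f hf
    rw [Fintype.mem_piFinset] at hf
    have hlo : ∀ i, 1 ≤ f i := fun i ↦ by have := hf i; rw [hF, Finset.mem_Icc] at this; exact this.1
    have hhi : ∀ i, f i ≤ M := fun i ↦ by have := hf i; rw [hF, Finset.mem_Icc] at this; exact this.2
    rw [hG, Finset.mem_Icc]
    constructor
    · calc 1 = ∏ _i : Fin k, (1 : ℕ) := (Finset.prod_const_one).symm
        _ ≤ ∏ i, f i := Finset.prod_le_prod' fun i _ ↦ hlo i
    · calc ∏ i, f i ≤ ∏ _i : Fin k, M := Finset.prod_le_prod' fun i _ ↦ hhi i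
        _ = M ^ k := Fin.prod_const k M
  set Mk : ℝ := ((M ^ k : ℕ) : ℝ) with hMk
  have hMkeq : Mk = (M : ℝ) ^ k := by rw [hMk]; push_cast; ring
  have hMk0 : 0 < Mk := by rw [hMkeq]; positivity
  have hMkT : Mk ≤ T ^ (2 * (k : ℝ)) := by
    rw [hMkeq, show (2 * (k : ℝ)) = (2 : ℝ) * (k : ℕ) by ring, Real.rpow_mul hT0.le,
      Real.rpow_natCast, show (T ^ (2 : ℝ)) = T ^ 2 by exact Real.rpow_two T]
    exact pow_le_pow_left₀ hM0.le hMT k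
  set D : ℝ := (Cd * Mk ^ η₁) ^ k with hD
  have hD0 : 0 ≤ D := by positivity
  have hrep : ∀ g ∈ G,
      (((Fintype.piFinset (fun _ : Fin k ↦ F)).filter (fun f ↦ ∏ i, f i = g)).card : ℝ) ≤ D := by
    intro g hg
    have hg' : 1 ≤ g ∧ g ≤ M ^ k := by rw [hG, Finset.mem_Icc] at hg; exact hg
    have hg0 : g ≠ 0 := by omega
    have hgle : (g : ℝ) ≤ Mk := by rw [hMk]; exact_mod_cast hg'.2
    have hdg : (g.divisors.card : ℝ) ≤ Cd * Mk ^ η₁ :=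
      (hCd g).trans (mul_le_mul_of_nonneg_left (Real.rpow_le_rpow (Nat.cast_nonneg g) hgle hη₁0.le) hCd0)
    calc (((Fintype.piFinset (fun _ : Fin k ↦ F)).filter (fun f ↦ ∏ i, f i = g)).card : ℝ)
        ≤ ((g.divisors.card ^ k : ℕ) : ℝ) := by exact_mod_cast card_tuples_prod_eq_le F k hg0
      _ = (g.divisors.card : ℝ) ^ k := by push_cast; ring
      _ ≤ D := by rw [hD]; exact pow_le_pow_left₀ (Nat.cast_nonneg _) hdg k
  have hYle : Y ≤ D ^ 2 * dps W G (fun _ ↦ (1 : ℂ)) := sum_norm_pow_sq_le_dps W hG0 k hFG ha1 hD0 hrep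
  -- Step 3: Heath-Brown on `G = {1} ∪ (1, M^k]`, the latter cut into dyadic pieces
  have hsplit : G = {1} ∪ Finset.Ioc 1 (M ^ k) := by
    ext m; simp only [hG, Finset.mem_union, Finset.mem_singleton, Finset.mem_Icc, Finset.mem_Ioc]; omega
  have hdisj : Disjoint ({1} : Finset ℕ) (Finset.Ioc 1 (M ^ k)) := by
    rw [Finset.disjoint_singleton_left, Finset.mem_Ioc]; omega
  have hone : dps W ({1} : Finset ℕ) (fun _ ↦ (1 : ℂ)) ≤ R ^ 2 := by
    unfold dps
    have : ∀ t ∈ W, ∀ t' ∈ W, ‖∑ n ∈ ({1} : Finset ℕ), (1 : ℂ) * twist n (t - t')‖ ^ 2 ≤ 1 := by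
      intro t _ t' _
      rw [Finset.sum_singleton, one_mul]
      exact pow_le_one₀ (norm_nonneg _) (norm_twist_le 1 _)
    calc ∑ t ∈ W, ∑ t' ∈ W, ‖∑ n ∈ ({1} : Finset ℕ), (1 : ℂ) * twist n (t - t')‖ ^ 2
        ≤ ∑ t ∈ W, ∑ t' ∈ W, (1 : ℝ) := Finset.sum_le_sum fun t ht ↦ Finset.sum_le_sum fun t' ht' ↦ this t ht t' ht'
      _ = R ^ 2 := by simp [hR]; ring
  set B : ℕ := Nat.log 2 (M ^ k) with hB
  set S : Finset ℕ := Finset.range (B + 1) with hS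
  have hpart : ∀ m ∈ Finset.Ioc 1 (M ^ k), Nat.log 2 (m - 1) ∈ S := by
    intro m hm
    rw [Finset.mem_Ioc] at hm
    rw [hS, Finset.mem_range]
    exact Nat.lt_succ_of_le (Nat.log_mono_right (by omega))
  have hblocks := dps_le_card_mul_sum_filter W (Finset.Ioc 1 (M ^ k)) (fun _ ↦ (1 : ℂ)) S
    (fun m ↦ Nat.log 2 (m - 1)) hpart
  have hScard : (S.card : ℝ) = B + 1 := by rw [hS, Finset.card_range]; push_cast; ring
  have hB1 : (B : ℝ) + 1 ≤ Cη * Mk ^ η₃ := by rw [hMk]; exact natLog_add_one_le hη₃0 hMk1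
  have h2B : (2 : ℕ) ^ B ≤ M ^ k := Nat.pow_log_le_self 2 (by omega)
  -- each dyadic piece, by the majorant principle and Heath-Brown
  have hpiece : ∀ i ∈ S, dps W ((Finset.Ioc 1 (M ^ k)).filter (fun m ↦ Nat.log 2 (m - 1) = i))
      (fun _ ↦ (1 : ℂ)) ≤ 2 * T ^ (η / 2) * X := by
    intro i hi
    rw [hS, Finset.mem_range] at hi
    have h2i : 2 ^ i ≤ M ^ k := le_trans (Nat.pow_le_pow_right (by norm_num) (Nat.lt_succ_iff.mp hi)) h2B
    have h2ir : ((2 ^ i : ℕ) : ℝ) ≤ Mk := by rw [hMk]; exact_mod_cast h2i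
    have hsub : (Finset.Ioc 1 (M ^ k)).filter (fun m ↦ Nat.log 2 (m - 1) = i) ⊆
        Finset.Ioc (2 ^ i) (2 * 2 ^ i) := by
      intro m hm
      have := pairB_mem_dyadic_piece hm le_rfl
      rw [Finset.mem_Ioc]; constructor
      · exact this.1
      · rw [pow_succ] at this; omega
    have h0 : 0 ∉ Finset.Ioc (2 ^ i) (2 * 2 ^ i) := by simp
    have hmaj : dps W ((Finset.Ioc 1 (M ^ k)).filter (fun m ↦ Nat.log 2 (m - 1) = i)) (fun _ ↦ (1 : ℂ)) ≤
        dps W (Finset.Ioc (2 ^ i) (2 * 2 ^ i)) (fun _ ↦ (((1 : ℝ)) : ℂ)) :=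
      dps_le_of_norm_le W hsub h0 (b := fun _ ↦ (1 : ℝ)) (fun _ _ ↦ by simp) (fun _ _ ↦ zero_le_one)
    have hHB := hCh (2 ^ i) Nat.one_le_two_pow
    have hL : ((2 ^ i : ℕ) : ℝ) ≤ Mk := h2ir
    have hL0 : (0 : ℝ) ≤ ((2 ^ i : ℕ) : ℝ) := Nat.cast_nonneg _
    have hXi : R ^ 2 * ((2 ^ i : ℕ) : ℝ) + R * (((2 ^ i : ℕ) : ℝ)) ^ 2 +
        R ^ (5 / 4 : ℝ) * T ^ (1 / 2 : ℝ) * ((2 ^ i : ℕ) : ℝ) ≤ X := by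
      rw [hX, ← hMkeq, show (M : ℝ) ^ (2 * k) = Mk ^ 2 by rw [hMkeq, ← pow_mul, mul_comm]]
      have h1 : R ^ 2 * ((2 ^ i : ℕ) : ℝ) ≤ R ^ 2 * Mk := mul_le_mul_of_nonneg_left hL (by positivity)
      have h2 : R * (((2 ^ i : ℕ) : ℝ)) ^ 2 ≤ R * Mk ^ 2 :=
        mul_le_mul_of_nonneg_left (pow_le_pow_left₀ hL0 hL 2) hR0
      have h3 : R ^ (5 / 4 : ℝ) * T ^ (1 / 2 : ℝ) * ((2 ^ i : ℕ) : ℝ) ≤ R ^ (5 / 4 : ℝ) * T ^ (1 / 2 : ℝ) * Mk :=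
        mul_le_mul_of_nonneg_left hL (by positivity)
      linarith
    have hcast : dps W (Finset.Ioc (2 ^ i) (2 * 2 ^ i)) (fun _ ↦ (((1 : ℝ)) : ℂ)) =
        dps W (Finset.Ioc (2 ^ i) (2 * 2 ^ i)) (fun _ ↦ (1 : ℂ)) := by simp
    rw [hcast] at hmaj
    calc _ ≤ dps W (Finset.Ioc (2 ^ i) (2 * 2 ^ i)) (fun _ ↦ (1 : ℂ)) := hmaj
      _ ≤ 2 * T ^ (η / 2) * (R ^ 2 * ((2 ^ i : ℕ) : ℝ) + R * (((2 ^ i : ℕ) : ℝ)) ^ 2 +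
          R ^ (5 / 4 : ℝ) * T ^ (1 / 2 : ℝ) * ((2 ^ i : ℕ) : ℝ)) := hHB
      _ ≤ 2 * T ^ (η / 2) * X := mul_le_mul_of_nonneg_left hXi (by positivity)
  have hIoc : dps W (Finset.Ioc 1 (M ^ k)) (fun _ ↦ (1 : ℂ)) ≤ ((B : ℝ) + 1) * (((B : ℝ) + 1) * (2 * T ^ (η / 2) * X)) := by
    refine hblocks.trans ?_
    rw [hScard]
    refine mul_le_mul_of_nonneg_left ?_ (by positivity)
    calc ∑ i ∈ S, dps W ((Finset.Ioc 1 (M ^ k)).filter (fun m ↦ Nat.log 2 (m - 1) = i)) (fun _ ↦ (1 : ℂ))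
        ≤ ∑ i ∈ S, 2 * T ^ (η / 2) * X := Finset.sum_le_sum hpiece
      _ = ((B : ℝ) + 1) * (2 * T ^ (η / 2) * X) := by rw [Finset.sum_const, nsmul_eq_mul, hScard]
  have hTη2 : (1 : ℝ) ≤ T ^ (η / 2) := Real.one_le_rpow hT1 (by positivity)
  have hRX : R ^ 2 ≤ T ^ (η / 2) * X := by
    have h1 : R ^ 2 ≤ X := by
      rw [hX]
      have : R ^ 2 ≤ R ^ 2 * (M : ℝ) ^ k := le_mul_of_one_le_right (by positivity) (one_le_pow₀ hM1)
      have h2 : 0 ≤ R * (M : ℝ) ^ (2 * k) := by positivity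
      have h3 : 0 ≤ R ^ (5 / 4 : ℝ) * T ^ (1 / 2 : ℝ) * (M : ℝ) ^ k := by positivity
      linarith
    exact h1.trans (le_mul_of_one_le_left hX0 hTη2)
  have hB10 : (1 : ℝ) ≤ (B : ℝ) + 1 := by have : (0 : ℝ) ≤ B := Nat.cast_nonneg _; linarith
  have hG' : dps W G (fun _ ↦ (1 : ℂ)) ≤ 6 * ((B : ℝ) + 1) ^ 2 * (T ^ (η / 2) * X) := by
    rw [hsplit]
    refine (dps_union_le W hdisj _).trans ?_
    have hB2 : (1 : ℝ) ≤ ((B : ℝ) + 1) ^ 2 := one_le_pow₀ hB10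
    have h0 : 0 ≤ T ^ (η / 2) * X := by positivity
    calc 2 * (dps W ({1} : Finset ℕ) (fun _ ↦ (1 : ℂ)) + dps W (Finset.Ioc 1 (M ^ k)) (fun _ ↦ (1 : ℂ)))
        ≤ 2 * (T ^ (η / 2) * X + ((B : ℝ) + 1) * (((B : ℝ) + 1) * (2 * T ^ (η / 2) * X))) :=
          mul_le_mul_of_nonneg_left (add_le_add (hone.trans hRX) hIoc) zero_le_two
      _ = (2 + 4 * ((B : ℝ) + 1) ^ 2) * (T ^ (η / 2) * X) := by ring
      _ ≤ (6 * ((B : ℝ) + 1) ^ 2) * (T ^ (η / 2) * X) := by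
          refine mul_le_mul_of_nonneg_right ?_ h0
          linarith
      _ = _ := by ring
  -- Step 4: the losses `D² (B+1)² ≤ Cd^{2k} Cη² T^{η/2}`
  have hDle : D ^ 2 ≤ (Cd ^ k) ^ 2 * T ^ (η / 4) := by
    have h1 : D = Cd ^ k * (Mk ^ η₁) ^ k := by rw [hD, mul_pow]
    have h2 : (Mk ^ η₁) ^ k ≤ T ^ (η / 8) := by
      rw [← Real.rpow_natCast, ← Real.rpow_mul hMk0.le]
      calc Mk ^ (η₁ * (k : ℕ)) ≤ (T ^ (2 * (k : ℝ))) ^ (η₁ * (k : ℕ)) :=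
            Real.rpow_le_rpow hMk0.le hMkT (by positivity)
        _ = T ^ (2 * (k : ℝ) * (η₁ * k)) := by rw [← Real.rpow_mul hT0.le]
        _ = T ^ (η / 8) := by congr 1; rw [hη₁]; field_simp; ring
    have h3 : 0 ≤ (Mk ^ η₁) ^ k := by positivity
    calc D ^ 2 = (Cd ^ k) ^ 2 * ((Mk ^ η₁) ^ k) ^ 2 := by rw [h1, mul_pow]
      _ ≤ (Cd ^ k) ^ 2 * (T ^ (η / 8)) ^ 2 := by
          refine mul_le_mul_of_nonneg_left (pow_le_pow_left₀ h3 h2 2) (by positivity)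
      _ = (Cd ^ k) ^ 2 * T ^ (η / 4) := by
          rw [← Real.rpow_natCast (T ^ (η / 8)) 2, ← Real.rpow_mul hT0.le]; push_cast; ring_nf
  have hBle : ((B : ℝ) + 1) ^ 2 ≤ Cη ^ 2 * T ^ (η / 4) := by
    have h2 : Mk ^ η₃ ≤ T ^ (η / (8 : ℝ)) := by
      calc Mk ^ η₃ ≤ (T ^ (2 * (k : ℝ))) ^ η₃ := Real.rpow_le_rpow hMk0.le hMkT hη₃0.le
        _ = T ^ (2 * (k : ℝ) * η₃) := by rw [← Real.rpow_mul hT0.le]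
        _ = T ^ (η / 8) := by congr 1; rw [hη₃]; field_simp; ring
    have h0 : 0 ≤ (B : ℝ) + 1 := by positivity
    calc ((B : ℝ) + 1) ^ 2 ≤ (Cη * Mk ^ η₃) ^ 2 := pow_le_pow_left₀ h0 hB1 2
      _ ≤ (Cη * T ^ (η / 8)) ^ 2 := by
          refine pow_le_pow_left₀ (by positivity) (mul_le_mul_of_nonneg_left h2 hCη0) 2
      _ = Cη ^ 2 * T ^ (η / 4) := by
          rw [mul_pow, ← Real.rpow_natCast (T ^ (η / 8)) 2, ← Real.rpow_mul hT0.le]; push_cast; ring_nf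
  -- conclude
  have hTpow : T ^ (η / 4) * T ^ (η / 4) * T ^ (η / 2) = T ^ η := by
    rw [← Real.rpow_add hT0, ← Real.rpow_add hT0]; ring_nf
  calc Y ≤ D ^ 2 * dps W G (fun _ ↦ (1 : ℂ)) := hYle
    _ ≤ D ^ 2 * (6 * ((B : ℝ) + 1) ^ 2 * (T ^ (η / 2) * X)) := mul_le_mul_of_nonneg_left hG' (by positivity)
    _ = 6 * (D ^ 2 * ((B : ℝ) + 1) ^ 2) * T ^ (η / 2) * X := by ring
    _ ≤ 6 * (((Cd ^ k) ^ 2 * T ^ (η / 4)) * (Cη ^ 2 * T ^ (η / 4))) * T ^ (η / 2) * X := by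
        have : D ^ 2 * ((B : ℝ) + 1) ^ 2 ≤ ((Cd ^ k) ^ 2 * T ^ (η / 4)) * (Cη ^ 2 * T ^ (η / 4)) :=
          mul_le_mul hDle hBle (by positivity) (by positivity)
        refine mul_le_mul_of_nonneg_right (mul_le_mul_of_nonneg_right ?_ (by positivity)) hX0
        exact mul_le_mul_of_nonneg_left this (by norm_num)
    _ = 6 * (Cd ^ k) ^ 2 * Cη ^ 2 * (T ^ (η / 4) * T ^ (η / 4) * T ^ (η / 2)) * X := by ring
    _ = 6 * (Cd ^ k) ^ 2 * Cη ^ 2 * T ^ η * X := by rw [hTpow]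

/-- **Hölder over the pairs (Jutila (3.2)), uniform form**: if `∑_{t,t'} |D_M(t−t'+2πξ)|^{2k} ≤ Ψ` then
`∑_{t,t'} |D_M(t−t'+2πξ)| ≤ ((|W|²)^{2k−1} Ψ)^{1/(2k)}` (power mean over the `|W|²` pairs).
[cite: Jutila1977, Section 3 (3.2)] -/
theorem sum_norm_dirD_le_of_moment (W : Finset ℝ) (M : ℕ) (ξ : ℝ) {k : ℕ} (hk : 1 ≤ k) {Ψ : ℝ}
    (hΨ : ∑ t ∈ W, ∑ t' ∈ W, ‖dirD M (t - t' + 2 * π * ξ)‖ ^ (2 * k) ≤ Ψ) :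
    ∑ t ∈ W, ∑ t' ∈ W, ‖dirD M (t - t' + 2 * π * ξ)‖ ≤
      (((W.card : ℝ) ^ 2) ^ (2 * k - 1) * Ψ) ^ (1 / ((2 * k : ℕ) : ℝ)) := by
  classical
  have hq : 1 ≤ 2 * k := by omega
  have hx : ∀ p ∈ W ×ˢ W, 0 ≤ ‖dirD M (p.1 - p.2 + 2 * π * ξ)‖ := fun _ _ ↦ norm_nonneg _
  have h := pairB_sum_le_rpow_card_pow_mul_sum_pow (W ×ˢ W) hx hq
  rw [Finset.sum_product] at h
  simp only [Finset.sum_product, Finset.card_product] at h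
  refine h.trans (Real.rpow_le_rpow (by positivity) ?_ (by positivity))
  push_cast
  rw [← sq]
  exact mul_le_mul_of_nonneg_left hΨ (by positivity)

section weight

variable {w : ℝ → ℝ}

/-- Integrability of `ξ ↦ |H_w(ξ)| |D_M(τ + 2πξ)|`. [folklore] -/
private theorem pairB_integrable_norm_mel_mul_dirD (hw : ContDiff ℝ ∞ w)
    (hsupp : Function.support w ⊆ Set.Icc 1 2) (M : ℕ) (τ : ℝ) :
    Integrable fun ξ ↦ ‖mel w ξ‖ * ‖dirD M (τ + 2 * π * ξ)‖ := by
  have hDc : Continuous fun ξ : ℝ ↦ ‖dirD M (τ + 2 * π * ξ)‖ :=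
    ((continuous_dirD M).comp (continuous_const.add (continuous_const.mul continuous_id))).norm
  refine (mel_integrable hw hsupp).norm.mul_bdd (c := (M : ℝ)) hDc.aestronglyMeasurable
    (ae_of_all _ fun ξ ↦ ?_)
  rw [Real.norm_eq_abs, abs_of_nonneg (norm_nonneg _)]
  exact norm_dirD_le M _

set_option maxHeartbeats 800000 in
/-- **`∑ |B_N|` over a dyadic class of differences (Jutila (3.1)–(3.2) with Guth–Maynard's Lemma 6.2 as
the reflection step).** For `j ≥ 2` there is `C = C(w, j)` such that for `N ≥ 1`, `1 ≤ M`, `2M ≤ 2^K`,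
`T₀ ≥ 1`, every finite `W ⊂ ℝ` and every `Φ` with `∑_{t,t'∈W} |D_M(t−t'+2πξ)| ≤ Φ` for all `ξ`:
`∑_{t,t'∈W, T₀ ≤ |t−t'| ≤ 2T₀} |B_N(t−t')| ≤ 48√2 K ‖H_w‖₁ Φ T₀^{-1/2} + C|W|²(M log(2M) T₀^{-j} +
(1+2T₀)^j N^{-j} M^{2−j})` (`GuthMaynardS2.norm_coefB_le_main_add` termwise, the `ξ`-integral exchanged
with the sum over the pairs). [cite: Jutila1977, Section 3 (3.1)-(3.2)] -/
theorem sum_norm_coefB_class_le (hw : ContDiff ℝ ∞ w) (hsupp : Function.support w ⊆ Set.Icc 1 2)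
    {j : ℕ} (hj : 2 ≤ j) : ∃ C, 0 ≤ C ∧
    ∀ (N : ℝ), 1 ≤ N → ∀ (M K : ℕ), 1 ≤ M → 2 * (M : ℝ) ≤ 2 ^ K → ∀ (T₀ : ℝ), 1 ≤ T₀ →
    ∀ (W : Finset ℝ) (Φ : ℝ),
      (∀ ξ : ℝ, ∑ t ∈ W, ∑ t' ∈ W, ‖dirD M (t - t' + 2 * π * ξ)‖ ≤ Φ) →
      ∑ t ∈ W, ∑ t' ∈ W,
          (if T₀ ≤ |t - t'| ∧ |t - t'| ≤ 2 * T₀ then ‖coefB w N (t - t')‖ else 0) ≤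
        48 * Real.sqrt 2 * K * (∫ ξ, ‖mel w ξ‖) * Φ / Real.sqrt T₀ + C * (W.card : ℝ) ^ 2 *
          ((M : ℝ) * Real.log (2 * M) / T₀ ^ j + (1 + 2 * T₀) ^ j / (N ^ j * (M : ℝ) ^ (j - 2))) := by
  obtain ⟨C, hC0, hC⟩ := norm_coefB_le_main_add hw hsupp hj
  have hmi := mel_integrable hw hsupp
  set L : ℝ := ∫ ξ, ‖mel w ξ‖ with hL
  have hL0 : 0 ≤ L := integral_nonneg fun _ ↦ norm_nonneg _
  refine ⟨C, hC0, fun N hN M K hM hK T₀ hT₀ W Φ hΦ ↦ ?_⟩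
  have hN0 : 0 < N := by linarith
  have hM0 : (0 : ℝ) < M := by exact_mod_cast hM
  have hM1 : (1 : ℝ) ≤ M := by exact_mod_cast hM
  have hT0 : 0 < T₀ := by linarith
  have hsT0 : 0 < Real.sqrt T₀ := Real.sqrt_pos.mpr hT0
  have hlog0 : 0 ≤ Real.log (2 * M) := Real.log_nonneg (by linarith)
  have hΦ0 : 0 ≤ Φ := le_trans (Finset.sum_nonneg fun _ _ ↦ Finset.sum_nonneg fun _ _ ↦ norm_nonneg _) (hΦ 0)
  set I₁ : ℝ → ℝ := fun τ ↦ ∫ ξ, ‖mel w ξ‖ * ‖dirD M (τ + 2 * π * ξ)‖ with hI₁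
  have hI₁0 : ∀ τ, 0 ≤ I₁ τ := fun τ ↦ integral_nonneg fun _ ↦ by positivity
  -- the uniform bound for the negligible part on the class
  set Emax : ℝ := (M : ℝ) * Real.log (2 * M) / T₀ ^ j + (1 + 2 * T₀) ^ j / (N ^ j * (M : ℝ) ^ (j - 2)) with hEmax
  have hEmax0 : 0 ≤ Emax := by positivity
  have hpt : ∀ τ : ℝ, T₀ ≤ |τ| → |τ| ≤ 2 * T₀ →
      ‖coefB w N τ‖ ≤ 48 * Real.sqrt 2 * K / Real.sqrt T₀ * I₁ τ + C * Emax := by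
    intro τ h1 h2
    have hτ0 : 0 < |τ| := lt_of_lt_of_le hT0 h1
    have hτ : τ ≠ 0 := abs_pos.mp hτ0
    refine (hC N hN M K hM hK τ hτ).trans ?_
    have ha : 48 * Real.sqrt 2 * (K : ℝ) / Real.sqrt |τ| * I₁ τ ≤ 48 * Real.sqrt 2 * K / Real.sqrt T₀ * I₁ τ := by
      refine mul_le_mul_of_nonneg_right ?_ (hI₁0 τ)
      exact div_le_div_of_nonneg_left (by positivity) hsT0 (Real.sqrt_le_sqrt h1)
    have hb : (M : ℝ) * Real.log (2 * M) / |τ| ^ j + (1 + |τ|) ^ j / (N ^ j * (M : ℝ) ^ (j - 2)) ≤ Emax := by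
      have e1 : (M : ℝ) * Real.log (2 * M) / |τ| ^ j ≤ (M : ℝ) * Real.log (2 * M) / T₀ ^ j :=
        div_le_div_of_nonneg_left (by positivity) (by positivity) (pow_le_pow_left₀ hT0.le h1 j)
      have e2 : (1 + |τ|) ^ j / (N ^ j * (M : ℝ) ^ (j - 2)) ≤ (1 + 2 * T₀) ^ j / (N ^ j * (M : ℝ) ^ (j - 2)) := by
        refine div_le_div_of_nonneg_right ?_ (by positivity)
        exact pow_le_pow_left₀ (by positivity) (by linarith) j
      rw [hEmax]; linarith
    have := mul_le_mul_of_nonneg_left hb hC0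
    linarith
  -- termwise, then drop the condition
  have hterm : ∀ t ∈ W, ∀ t' ∈ W,
      (if T₀ ≤ |t - t'| ∧ |t - t'| ≤ 2 * T₀ then ‖coefB w N (t - t')‖ else 0) ≤
        48 * Real.sqrt 2 * K / Real.sqrt T₀ * I₁ (t - t') + C * Emax := by
    intro t _ t' _
    split_ifs with h
    · exact hpt (t - t') h.1 h.2
    · have := hI₁0 (t - t'); positivity
  have hsumI : ∑ t ∈ W, ∑ t' ∈ W, I₁ (t - t') ≤ L * Φ := by
    have hint : ∀ t t' : ℝ, Integrable fun ξ ↦ ‖mel w ξ‖ * ‖dirD M (t - t' + 2 * π * ξ)‖ :=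
      fun t t' ↦ pairB_integrable_norm_mel_mul_dirD hw hsupp M (t - t')
    have e : ∑ t ∈ W, ∑ t' ∈ W, I₁ (t - t') =
        ∫ ξ, ‖mel w ξ‖ * ∑ t ∈ W, ∑ t' ∈ W, ‖dirD M (t - t' + 2 * π * ξ)‖ := by
      simp only [hI₁, Finset.mul_sum]
      rw [integral_finsetSum _ (fun t _ ↦ integrable_finsetSum _ (fun t' _ ↦ hint t t'))]
      refine Finset.sum_congr rfl fun t _ ↦ ?_
      rw [integral_finsetSum _ (fun t' _ ↦ hint t t')]
    rw [e]
    calc ∫ ξ, ‖mel w ξ‖ * ∑ t ∈ W, ∑ t' ∈ W, ‖dirD M (t - t' + 2 * π * ξ)‖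
        ≤ ∫ ξ, ‖mel w ξ‖ * Φ := by
          refine integral_mono ?_ (hmi.norm.mul_const Φ) fun ξ ↦ ?_
          · have := integrable_finsetSum W (fun t (_ : t ∈ W) ↦
              integrable_finsetSum W (fun t' (_ : t' ∈ W) ↦ hint t t'))
            refine this.congr (ae_of_all _ fun ξ ↦ ?_)
            simp only [Finset.mul_sum]
          · exact mul_le_mul_of_nonneg_left (hΦ ξ) (norm_nonneg _)
      _ = L * Φ := by rw [integral_mul_const]
  calc ∑ t ∈ W, ∑ t' ∈ W,
        (if T₀ ≤ |t - t'| ∧ |t - t'| ≤ 2 * T₀ then ‖coefB w N (t - t')‖ else 0)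
      ≤ ∑ t ∈ W, ∑ t' ∈ W, (48 * Real.sqrt 2 * K / Real.sqrt T₀ * I₁ (t - t') + C * Emax) :=
        Finset.sum_le_sum fun t ht ↦ Finset.sum_le_sum fun t' ht' ↦ hterm t ht t' ht'
    _ = 48 * Real.sqrt 2 * K / Real.sqrt T₀ * ∑ t ∈ W, ∑ t' ∈ W, I₁ (t - t') +
        (W.card : ℝ) ^ 2 * (C * Emax) := by
        simp only [Finset.sum_add_distrib, Finset.sum_const, nsmul_eq_mul, ← Finset.mul_sum]
        ring
    _ ≤ 48 * Real.sqrt 2 * K / Real.sqrt T₀ * (L * Φ) + (W.card : ℝ) ^ 2 * (C * Emax) := by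
        gcongr
    _ = 48 * Real.sqrt 2 * K * L * Φ / Real.sqrt T₀ + C * (W.card : ℝ) ^ 2 * Emax := by ring

end weight

/-! ## §4. One dyadic class of differences (Jutila §3: the choice `M ≍ T₀/N`, (3.2), the display after it) -/

/-- `(M log(2M)) ≤ 2M²` for `M ≥ 1`. [folklore] -/
private theorem pairB_mul_log_le {x : ℝ} (hx : 1 ≤ x) : x * Real.log (2 * x) ≤ 2 * x ^ 2 := by
  have h1 : Real.log (2 * x) ≤ 2 * x := (Real.log_le_sub_one_of_pos (by linarith)).trans (by linarith)
  calc x * Real.log (2 * x) ≤ x * (2 * x) := mul_le_mul_of_nonneg_left h1 (by linarith)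
    _ = 2 * x ^ 2 := by ring

set_option maxHeartbeats 3000000 in
/-- **One dyadic class `2^i ≤ |t−t'| ≤ 2^{i+1}`** (`n = N`, threshold `Θ = n^{1−η} < 2^{i+1}`, length
`M = ⌈n^η 2^i/n⌉` as in the tree's `GuthMaynardS2.class_le`): combining the class bound
`sum_norm_coefB_class_le` (hypothesis `hCA`) with the uniform bound
`∑_{t,t'}|D_M| ≤ ((|W|²)^{2k−1} · moment)^{1/(2k)}` (`sum_norm_dirD_le_of_moment`, the moment from
`moment_dirD_le` as hypothesis `hmom`), and the domination
`|W|²M^k + |W|M^{2k} + |W|^{5/4}T^{1/2}M^k ≤ 3·9^k (n^η)^k M^k · |W|((T/n)^k + (|W|T)^{1/2})`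
(`|W| ≤ 2T`, `M ≤ 9n^ηT/n`), gives
`class_i ≤ 48√6 ‖H_w‖₁ (3·9^k C_M)^{1/(2k)} K T^{η_m/(2k)} n^η · n^{1/2}|W|^{2−1/k}(|W|((T/n)^k + (|W|T)^{1/2}))^{1/(2k)}`
`+ 243·3^j C (n|W|²T² n^{−ηj})` — Jutila's display after (3.2), p. 60, with Heath-Brown's theorem in
place of Lemma 3. [cite: Jutila1977, Section 3 display after (3.2)] -/
theorem sum_class_le (w : ℝ → ℝ) {k : ℕ} (hk : 1 ≤ k) {n T η ηm CA CM L : ℝ} {j K Mmax : ℕ}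
    (hCA0 : 0 ≤ CA) (hCM0 : 0 ≤ CM) (hL0 : 0 ≤ L)
    (hn1 : 1 ≤ n) (hT9 : 9 ≤ T) (hη0 : 0 < η) (hη1 : η ≤ 1 / 2) (hj : 2 ≤ j)
    (W : Finset ℝ) (hRT : (W.card : ℝ) ≤ 2 * T)
    (hMmax : 9 * n ^ η * T / n ≤ (Mmax : ℝ)) (hK2 : ∀ M : ℕ, M ≤ Mmax → 2 * (M : ℝ) ≤ 2 ^ K)
    (hCA : ∀ (M K' : ℕ), 1 ≤ M → 2 * (M : ℝ) ≤ 2 ^ K' → ∀ (T₀ : ℝ), 1 ≤ T₀ → ∀ (Φ : ℝ),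
      (∀ ξ : ℝ, ∑ t ∈ W, ∑ t' ∈ W, ‖dirD M (t - t' + 2 * π * ξ)‖ ≤ Φ) →
      ∑ t ∈ W, ∑ t' ∈ W, (if T₀ ≤ |t - t'| ∧ |t - t'| ≤ 2 * T₀ then ‖coefB w n (t - t')‖ else 0) ≤
        48 * Real.sqrt 2 * K' * L * Φ / Real.sqrt T₀ + CA * (W.card : ℝ) ^ 2 *
          ((M : ℝ) * Real.log (2 * M) / T₀ ^ j + (1 + 2 * T₀) ^ j / (n ^ j * (M : ℝ) ^ (j - 2))))
    (hmom : ∀ (M : ℕ), 1 ≤ M → (M : ℝ) ≤ T ^ 2 → ∀ ξ : ℝ,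
      ∑ t ∈ W, ∑ t' ∈ W, ‖dirD M (t - t' + 2 * π * ξ)‖ ^ (2 * k) ≤
        CM * T ^ ηm * ((W.card : ℝ) ^ 2 * (M : ℝ) ^ k + (W.card : ℝ) * (M : ℝ) ^ (2 * k) +
          (W.card : ℝ) ^ (5 / 4 : ℝ) * T ^ (1 / 2 : ℝ) * (M : ℝ) ^ k))
    {i : ℕ} (hiΘ : n ^ (1 - η) < (2 : ℝ) ^ (i + 1)) (hiT : (2 : ℝ) ^ i ≤ 3 * T) :
    ∑ t ∈ W, ∑ t' ∈ W,
        (if (2 : ℝ) ^ i ≤ |t - t'| ∧ |t - t'| ≤ 2 * 2 ^ i then n * ‖coefB w n (t - t')‖ else 0) ≤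
      48 * Real.sqrt 6 * L * (3 * 9 ^ k * CM) ^ (1 / ((2 * k : ℕ) : ℝ)) * K * T ^ (ηm / ((2 * k : ℕ) : ℝ)) *
        n ^ η * (n ^ (1 / 2 : ℝ) * (W.card : ℝ) ^ (2 - 1 / (k : ℝ)) *
          ((W.card : ℝ) * ((T / n) ^ k + ((W.card : ℝ) * T) ^ (1 / 2 : ℝ))) ^ (1 / ((2 * k : ℕ) : ℝ))) +
      243 * 3 ^ j * CA * (n * (W.card : ℝ) ^ 2 * T ^ 2 * n ^ (-(η * j))) := by
  have hn0 : 0 < n := by linarith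
  have hT1 : (1 : ℝ) ≤ T := by linarith
  have hT0 : 0 < T := by linarith
  have hk0 : (0 : ℝ) < k := by exact_mod_cast hk
  set R : ℝ := (W.card : ℝ) with hR
  have hR0 : 0 ≤ R := Nat.cast_nonneg _
  set Θ : ℝ := n ^ (1 - η) with hΘ
  set T₀ : ℝ := 2 ^ i with hT₀
  have hT₀1 : 1 ≤ T₀ := one_le_pow₀ one_le_two
  have hT₀0 : 0 < T₀ := by linarith
  have hΘT₀ : Θ < 2 * T₀ := by rw [hT₀, ← pow_succ']; exact hiΘ
  have hΘ0 : 0 < Θ := by positivity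
  have hnηpos : 0 < n ^ η := Real.rpow_pos_of_pos hn0 η
  have hnη1 : 1 ≤ n ^ η := Real.one_le_rpow hn1 hη0.le
  have hnη : n ^ η ≤ n := by
    conv_rhs => rw [← Real.rpow_one n]
    exact Real.rpow_le_rpow_of_exponent_le hn1 (by linarith)
  have en : n ^ η * Θ = n := by
    rw [hΘ, ← Real.rpow_add hn0]; ring_nf; exact Real.rpow_one n
  -- the length `M`
  set x : ℝ := n ^ η * T₀ / n with hx
  have hx0 : 1 / 2 < x := by
    rw [hx, lt_div_iff₀ hn0]
    calc 1 / 2 * n = 1 / 2 * (n ^ η * Θ) := by rw [en]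
      _ < 1 / 2 * (n ^ η * (2 * T₀)) :=
          mul_lt_mul_of_pos_left (mul_lt_mul_of_pos_left hΘT₀ hnηpos) (by norm_num)
      _ = n ^ η * T₀ := by ring
  set M : ℕ := ⌈x⌉₊ with hM
  have hM1 : 1 ≤ M := Nat.one_le_iff_ne_zero.mpr (Nat.pos_iff_ne_zero.mp (Nat.ceil_pos.mpr (by linarith)))
  have hMr1 : (1 : ℝ) ≤ M := by exact_mod_cast hM1
  have hM0 : (0 : ℝ) < M := by linarith
  have hxM : x ≤ M := Nat.le_ceil x
  have hMx : (M : ℝ) ≤ 3 * x := by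
    have := Nat.ceil_lt_add_one (show 0 ≤ x by linarith); rw [hM]; linarith
  have hMT₀ : (M : ℝ) ≤ 3 * n ^ η * T₀ / n := by
    calc (M : ℝ) ≤ 3 * x := hMx
      _ = 3 * n ^ η * T₀ / n := by rw [hx]; ring
  have hx3 : x ≤ 3 * n ^ η * T / n := by
    rw [hx]
    refine div_le_div_of_nonneg_right ?_ hn0.le
    calc n ^ η * T₀ ≤ n ^ η * (3 * T) := mul_le_mul_of_nonneg_left hiT hnηpos.le
      _ = 3 * n ^ η * T := by ring
  have hM9 : (M : ℝ) ≤ 9 * n ^ η * T / n := by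
    calc (M : ℝ) ≤ 3 * x := hMx
      _ ≤ 3 * (3 * n ^ η * T / n) := by linarith [hx3]
      _ = 9 * n ^ η * T / n := by ring
  have hMMmax : M ≤ Mmax := by
    rw [hM]; refine Nat.ceil_le.mpr (hx3.trans (le_trans ?_ hMmax))
    refine div_le_div_of_nonneg_right ?_ hn0.le
    nlinarith [hnηpos, hT0]
  have hMK : 2 * (M : ℝ) ≤ 2 ^ K := hK2 M hMMmax
  have hM9T : (M : ℝ) ≤ 9 * T := by
    refine hM9.trans ?_
    rw [div_le_iff₀ hn0]
    calc 9 * n ^ η * T = 9 * T * n ^ η := by ring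
      _ ≤ 9 * T * n := mul_le_mul_of_nonneg_left hnη (by positivity)
  have hMT2 : (M : ℝ) ≤ T ^ 2 := hM9T.trans (by nlinarith)
  -- the uniform bound `Φ` from the moment
  set X : ℝ := R ^ 2 * (M : ℝ) ^ k + R * (M : ℝ) ^ (2 * k) + R ^ (5 / 4 : ℝ) * T ^ (1 / 2 : ℝ) * (M : ℝ) ^ k
    with hX
  have hX0 : 0 ≤ X := by positivity
  set Ψ : ℝ := CM * T ^ ηm * X with hΨ
  have hΨ0 : 0 ≤ Ψ := by positivity
  have hΨb : ∀ ξ : ℝ, ∑ t ∈ W, ∑ t' ∈ W, ‖dirD M (t - t' + 2 * π * ξ)‖ ^ (2 * k) ≤ Ψ :=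
    fun ξ ↦ hmom M hM1 hMT2 ξ
  set q : ℝ := ((2 * k : ℕ) : ℝ) with hq
  have hqk : q = 2 * (k : ℝ) := by rw [hq]; push_cast; ring
  have hq0 : 0 < q := by rw [hqk]; positivity
  have hiq0 : 0 ≤ 1 / q := by positivity
  set Φ : ℝ := ((R ^ 2) ^ (2 * k - 1) * Ψ) ^ (1 / q) with hΦ
  have hΦ0 : 0 ≤ Φ := by positivity
  have hΦb : ∀ ξ : ℝ, ∑ t ∈ W, ∑ t' ∈ W, ‖dirD M (t - t' + 2 * π * ξ)‖ ≤ Φ :=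
    fun ξ ↦ sum_norm_dirD_le_of_moment W M ξ hk (hΨb ξ)
  have hcl := hCA M K hM1 hMK T₀ hT₀1 Φ hΦb
  -- factor `n` out of the class sum
  have hfac : ∑ t ∈ W, ∑ t' ∈ W,
      (if (2 : ℝ) ^ i ≤ |t - t'| ∧ |t - t'| ≤ 2 * 2 ^ i then n * ‖coefB w n (t - t')‖ else 0) =
      n * ∑ t ∈ W, ∑ t' ∈ W,
        (if T₀ ≤ |t - t'| ∧ |t - t'| ≤ 2 * T₀ then ‖coefB w n (t - t')‖ else 0) := by
    rw [Finset.mul_sum]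
    refine Finset.sum_congr rfl fun t _ ↦ ?_
    rw [Finset.mul_sum]
    refine Finset.sum_congr rfl fun t' _ ↦ ?_
    split_ifs <;> simp
  rw [hfac]
  refine (mul_le_mul_of_nonneg_left hcl hn0.le).trans ?_
  rw [mul_add]
  refine add_le_add ?_ ?_
  · -- (I) the main part
    set u : ℝ := (R * T) ^ (1 / 2 : ℝ) with hu
    have hu0 : 0 ≤ u := by positivity
    set Q : ℝ := R * ((T / n) ^ k + u) with hQ
    have hQ0 : 0 ≤ Q := by positivity
    -- the domination `X ≤ 3·9^k (n^η)^k M^k Q`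
    have hMk9 : (M : ℝ) ^ k ≤ 9 ^ k * (n ^ η) ^ k * (T / n) ^ k := by
      have h1 : (M : ℝ) ≤ 9 * n ^ η * (T / n) := hM9.trans (le_of_eq (by ring))
      calc (M : ℝ) ^ k ≤ (9 * n ^ η * (T / n)) ^ k := pow_le_pow_left₀ hM0.le h1 k
        _ = 9 ^ k * (n ^ η) ^ k * (T / n) ^ k := by rw [mul_pow, mul_pow]
    have hR2u : R ^ 2 ≤ 2 * R * u := by
      have h1 : R ^ 2 ≤ (2 * u) ^ 2 := by
        have e : (2 * u) ^ 2 = 4 * (R * T) := by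
          rw [mul_pow, hu, ← Real.rpow_natCast ((R * T) ^ (1 / 2 : ℝ)) 2, ← Real.rpow_mul (by positivity)]
          norm_num
        rw [e]; nlinarith
      have h2 : R ≤ 2 * u := (pow_le_pow_iff_left₀ hR0 (by positivity) two_ne_zero).mp h1
      nlinarith
    have hR54 : R ^ (5 / 4 : ℝ) * T ^ (1 / 2 : ℝ) ≤ R * u := by
      rcases Nat.eq_zero_or_pos W.card with h0 | hpos
      · have hR00 : R = 0 := by rw [hR]; exact_mod_cast h0
        rw [hR00, Real.zero_rpow (by norm_num)]; simp
      · have hR1 : (1 : ℝ) ≤ R := by rw [hR]; exact_mod_cast hpos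
        have h1 : R ^ (5 / 4 : ℝ) ≤ R ^ (3 / 2 : ℝ) := Real.rpow_le_rpow_of_exponent_le hR1 (by norm_num)
        have h2 : R ^ (3 / 2 : ℝ) = R * R ^ (1 / 2 : ℝ) := by
          rw [show (3 / 2 : ℝ) = 1 + 1 / 2 by norm_num, Real.rpow_add (by linarith), Real.rpow_one]
        have h3 : R ^ (1 / 2 : ℝ) * T ^ (1 / 2 : ℝ) = u := by rw [hu, Real.mul_rpow hR0 hT0.le]
        calc R ^ (5 / 4 : ℝ) * T ^ (1 / 2 : ℝ) ≤ R ^ (3 / 2 : ℝ) * T ^ (1 / 2 : ℝ) :=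
            mul_le_mul_of_nonneg_right h1 (by positivity)
          _ = R * (R ^ (1 / 2 : ℝ) * T ^ (1 / 2 : ℝ)) := by rw [h2]; ring
          _ = R * u := by rw [h3]
    have h9k1 : (1 : ℝ) ≤ 9 ^ k * (n ^ η) ^ k := one_le_mul_of_one_le_of_one_le (one_le_pow₀ (by norm_num)) (one_le_pow₀ hnη1)
    have hXQ : X ≤ 3 * 9 ^ k * CM ^ (0 : ℕ) * (n ^ η) ^ k * (M : ℝ) ^ k * Q := by
      rw [pow_zero, mul_one]
      have hMk0 : 0 ≤ (M : ℝ) ^ k := by positivity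
      have h1 : R ^ 2 * (M : ℝ) ^ k ≤ 2 * R * u * (M : ℝ) ^ k := mul_le_mul_of_nonneg_right hR2u hMk0
      have h3 : R ^ (5 / 4 : ℝ) * T ^ (1 / 2 : ℝ) * (M : ℝ) ^ k ≤ R * u * (M : ℝ) ^ k :=
        mul_le_mul_of_nonneg_right hR54 hMk0
      have h2 : R * (M : ℝ) ^ (2 * k) = R * (M : ℝ) ^ k * (M : ℝ) ^ k := by rw [two_mul, pow_add]; ring
      have h4 : X ≤ 3 * (R * (M : ℝ) ^ k * ((M : ℝ) ^ k + u)) := by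
        have h5 : 0 ≤ R * (M : ℝ) ^ k * (M : ℝ) ^ k := by positivity
        have h6 : 0 ≤ R * u * (M : ℝ) ^ k := by positivity
        have e : 3 * (R * (M : ℝ) ^ k * ((M : ℝ) ^ k + u)) =
            3 * (R * (M : ℝ) ^ k * (M : ℝ) ^ k) + 3 * (R * u * (M : ℝ) ^ k) := by ring
        rw [hX, h2, e]
        linarith [h1, h3, h5, h6]
      have h5 : (M : ℝ) ^ k + u ≤ 9 ^ k * (n ^ η) ^ k * ((T / n) ^ k + u) := by
        rw [mul_add]
        exact add_le_add hMk9 (le_mul_of_one_le_left hu0 h9k1)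
      calc X ≤ 3 * (R * (M : ℝ) ^ k * ((M : ℝ) ^ k + u)) := h4
        _ ≤ 3 * (R * (M : ℝ) ^ k * (9 ^ k * (n ^ η) ^ k * ((T / n) ^ k + u))) := by
            gcongr
        _ = 3 * 9 ^ k * (n ^ η) ^ k * (M : ℝ) ^ k * Q := by rw [hQ]; ring
    rw [pow_zero, mul_one] at hXQ
    -- `Φ ≤ R^{2−1/k} Q^{1/q} (3·9^k CM)^{1/q} T^{ηm/q} (n^η)^{1/2} M^{1/2}`
    set Cst : ℝ := 3 * 9 ^ k * CM with hCst
    have hCst0 : 0 ≤ Cst := by positivity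
    have hprod : (R ^ 2) ^ (2 * k - 1) * Ψ ≤
        (R ^ 2) ^ (2 * k - 1) * Q * Cst * T ^ ηm * (n ^ η) ^ k * (M : ℝ) ^ k := by
      calc (R ^ 2) ^ (2 * k - 1) * Ψ = (R ^ 2) ^ (2 * k - 1) * (CM * T ^ ηm) * X := by rw [hΨ]; ring
        _ ≤ (R ^ 2) ^ (2 * k - 1) * (CM * T ^ ηm) * (3 * 9 ^ k * (n ^ η) ^ k * (M : ℝ) ^ k * Q) :=
            mul_le_mul_of_nonneg_left hXQ (by positivity)
        _ = _ := by rw [hCst]; ring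
    have hΦ1 : Φ ≤ ((R ^ 2) ^ (2 * k - 1) * Q * Cst * T ^ ηm * (n ^ η) ^ k * (M : ℝ) ^ k) ^ (1 / q) :=
      Real.rpow_le_rpow (by positivity) hprod hiq0
    have e1 : ((R ^ 2) ^ (2 * k - 1) * Q * Cst * T ^ ηm * (n ^ η) ^ k * (M : ℝ) ^ k) ^ (1 / q) =
        ((R ^ 2) ^ (2 * k - 1) * Q * Cst * T ^ ηm * (n ^ η) ^ k) ^ (1 / q) * ((M : ℝ) ^ k) ^ (1 / q) :=
      Real.mul_rpow (by positivity) (by positivity)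
    have e2 : ((R ^ 2) ^ (2 * k - 1) * Q * Cst * T ^ ηm * (n ^ η) ^ k) ^ (1 / q) =
        ((R ^ 2) ^ (2 * k - 1) * Q * Cst * T ^ ηm) ^ (1 / q) * ((n ^ η) ^ k) ^ (1 / q) :=
      Real.mul_rpow (by positivity) (by positivity)
    have e3 : ((R ^ 2) ^ (2 * k - 1) * Q * Cst * T ^ ηm) ^ (1 / q) =
        ((R ^ 2) ^ (2 * k - 1) * Q * Cst) ^ (1 / q) * (T ^ ηm) ^ (1 / q) :=
      Real.mul_rpow (by positivity) (by positivity)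
    have e4 : ((R ^ 2) ^ (2 * k - 1) * Q * Cst) ^ (1 / q) =
        ((R ^ 2) ^ (2 * k - 1) * Q) ^ (1 / q) * Cst ^ (1 / q) :=
      Real.mul_rpow (by positivity) hCst0
    have e5 : ((R ^ 2) ^ (2 * k - 1) * Q) ^ (1 / q) = ((R ^ 2) ^ (2 * k - 1)) ^ (1 / q) * Q ^ (1 / q) :=
      Real.mul_rpow (by positivity) hQ0
    have eR : ((R ^ 2) ^ (2 * k - 1)) ^ (1 / q) = R ^ (2 - 1 / (k : ℝ)) := by
      rw [← pow_mul, ← Real.rpow_natCast R (2 * (2 * k - 1)), ← Real.rpow_mul hR0]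
      congr 1
      have h21 : ((2 * (2 * k - 1) : ℕ) : ℝ) = 2 * (2 * (k : ℝ) - 1) := by
        rw [Nat.cast_mul, Nat.cast_sub (by omega)]; push_cast; ring
      rw [h21, hqk]; field_simp
    have eT : (T ^ ηm) ^ (1 / q) = T ^ (ηm / q) := by
      rw [← Real.rpow_mul hT0.le]; congr 1; field_simp
    have eN : ((n ^ η) ^ k) ^ (1 / q) = (n ^ η) ^ (1 / 2 : ℝ) := by
      rw [← Real.rpow_natCast (n ^ η) k, ← Real.rpow_mul hnηpos.le]
      congr 1; rw [hqk]; field_simp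
    have eM : ((M : ℝ) ^ k) ^ (1 / q) = (M : ℝ) ^ (1 / 2 : ℝ) := by
      rw [← Real.rpow_natCast (M : ℝ) k, ← Real.rpow_mul hM0.le]
      congr 1; rw [hqk]; field_simp
    have hΦ2 : Φ ≤ R ^ (2 - 1 / (k : ℝ)) * Q ^ (1 / q) * Cst ^ (1 / q) * T ^ (ηm / q) *
        (n ^ η) ^ (1 / 2 : ℝ) * (M : ℝ) ^ (1 / 2 : ℝ) := by
      refine hΦ1.trans (le_of_eq ?_)
      rw [e1, e2, e3, e4, e5, eR, eT, eN, eM]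
    -- `n M^{1/2} / √T₀ ≤ √3 (n^η)^{1/2} n^{1/2}`
    have hB : n * (M : ℝ) ^ (1 / 2 : ℝ) / Real.sqrt T₀ ≤ Real.sqrt 3 * (n ^ η) ^ (1 / 2 : ℝ) * n ^ (1 / 2 : ℝ) := by
      have h1 : (M : ℝ) / T₀ ≤ 3 * n ^ η / n := by
        rw [div_le_iff₀ hT₀0]; refine hMT₀.trans (le_of_eq ?_); field_simp
      have h2 : ((M : ℝ) / T₀) ^ (1 / 2 : ℝ) ≤ (3 * n ^ η / n) ^ (1 / 2 : ℝ) :=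
        Real.rpow_le_rpow (by positivity) h1 (by norm_num)
      have e6 : (M : ℝ) ^ (1 / 2 : ℝ) / Real.sqrt T₀ = ((M : ℝ) / T₀) ^ (1 / 2 : ℝ) := by
        rw [Real.sqrt_eq_rpow, Real.div_rpow hM0.le hT₀0.le]
      have e7 : (3 * n ^ η / n) ^ (1 / 2 : ℝ) = Real.sqrt 3 * (n ^ η) ^ (1 / 2 : ℝ) / n ^ (1 / 2 : ℝ) := by
        rw [Real.div_rpow (by positivity) hn0.le, Real.mul_rpow (by norm_num) hnηpos.le, Real.sqrt_eq_rpow]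
      have e8 : n / n ^ (1 / 2 : ℝ) = n ^ (1 / 2 : ℝ) := by
        rw [div_eq_iff (by positivity), ← Real.rpow_add hn0]; norm_num
      calc n * (M : ℝ) ^ (1 / 2 : ℝ) / Real.sqrt T₀ = n * ((M : ℝ) / T₀) ^ (1 / 2 : ℝ) := by
            rw [mul_div_assoc, e6]
        _ ≤ n * (3 * n ^ η / n) ^ (1 / 2 : ℝ) := mul_le_mul_of_nonneg_left h2 hn0.le
        _ = Real.sqrt 3 * (n ^ η) ^ (1 / 2 : ℝ) * (n / n ^ (1 / 2 : ℝ)) := by rw [e7]; ring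
        _ = Real.sqrt 3 * (n ^ η) ^ (1 / 2 : ℝ) * n ^ (1 / 2 : ℝ) := by rw [e8]
    have eNN : (n ^ η) ^ (1 / 2 : ℝ) * (n ^ η) ^ (1 / 2 : ℝ) = n ^ η := by
      rw [← Real.rpow_add hnηpos]; norm_num
    have e26 : Real.sqrt 2 * Real.sqrt 3 = Real.sqrt 6 := by
      rw [← Real.sqrt_mul (by norm_num : (0:ℝ) ≤ 2)]; norm_num
    -- assemble the main part
    have hK0 : (0 : ℝ) ≤ K := Nat.cast_nonneg _
    calc n * (48 * Real.sqrt 2 * K * L * Φ / Real.sqrt T₀)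
        ≤ n * (48 * Real.sqrt 2 * K * L * (R ^ (2 - 1 / (k : ℝ)) * Q ^ (1 / q) * Cst ^ (1 / q) * T ^ (ηm / q) *
            (n ^ η) ^ (1 / 2 : ℝ) * (M : ℝ) ^ (1 / 2 : ℝ)) / Real.sqrt T₀) := by
          refine mul_le_mul_of_nonneg_left ?_ hn0.le
          refine div_le_div_of_nonneg_right ?_ (Real.sqrt_nonneg _)
          exact mul_le_mul_of_nonneg_left hΦ2 (by positivity)
      _ = 48 * Real.sqrt 2 * L * Cst ^ (1 / q) * K * T ^ (ηm / q) * (n ^ η) ^ (1 / 2 : ℝ) *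
            (R ^ (2 - 1 / (k : ℝ)) * Q ^ (1 / q)) * (n * (M : ℝ) ^ (1 / 2 : ℝ) / Real.sqrt T₀) := by
          ring
      _ ≤ 48 * Real.sqrt 2 * L * Cst ^ (1 / q) * K * T ^ (ηm / q) * (n ^ η) ^ (1 / 2 : ℝ) *
            (R ^ (2 - 1 / (k : ℝ)) * Q ^ (1 / q)) * (Real.sqrt 3 * (n ^ η) ^ (1 / 2 : ℝ) * n ^ (1 / 2 : ℝ)) :=
          mul_le_mul_of_nonneg_left hB (by positivity)
      _ = 48 * (Real.sqrt 2 * Real.sqrt 3) * L * Cst ^ (1 / q) * K * T ^ (ηm / q) *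
            ((n ^ η) ^ (1 / 2 : ℝ) * (n ^ η) ^ (1 / 2 : ℝ)) *
            (n ^ (1 / 2 : ℝ) * R ^ (2 - 1 / (k : ℝ)) * Q ^ (1 / q)) := by ring
      _ = 48 * Real.sqrt 6 * L * Cst ^ (1 / q) * K * T ^ (ηm / q) * n ^ η *
            (n ^ (1 / 2 : ℝ) * R ^ (2 - 1 / (k : ℝ)) * Q ^ (1 / q)) := by rw [e26, eNN]
  · -- (II) the negligible part
    have hM2 : (M : ℝ) ^ 2 ≤ 81 * T ^ 2 := by nlinarith [hM9T, hM0]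
    -- (a) `M log(2M)/T₀^j ≤ 162 T² 2^j n^{-ηj}`
    have hΘ2 : Θ / 2 ≤ T₀ := by linarith
    have hT₀j : 1 / T₀ ^ j ≤ (2 : ℝ) ^ j * n ^ (-(η * j)) := by
      have h4 : (Θ / 2) ^ j ≤ T₀ ^ j := pow_le_pow_left₀ (by positivity) hΘ2 _
      have h5 : 1 / T₀ ^ j ≤ 1 / (Θ / 2) ^ j := one_div_le_one_div_of_le (by positivity) h4
      refine h5.trans ?_
      have e : 1 / (Θ / 2) ^ j = (2 : ℝ) ^ j * n ^ (-((1 - η) * j)) := by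
        rw [div_pow, one_div, inv_div, hΘ, ← Real.rpow_natCast (n ^ (1 - η)) j, ← Real.rpow_mul hn0.le,
          Real.rpow_neg hn0.le, div_eq_mul_inv]
      rw [e]
      refine mul_le_mul_of_nonneg_left (Real.rpow_le_rpow_of_exponent_le hn1 ?_) (by positivity)
      have : 0 ≤ (j : ℝ) := Nat.cast_nonneg _
      nlinarith
    have ha : (M : ℝ) * Real.log (2 * M) / T₀ ^ j ≤ 162 * T ^ 2 * ((2 : ℝ) ^ j * n ^ (-(η * j))) := by
      have h1 : (M : ℝ) * Real.log (2 * M) ≤ 162 * T ^ 2 := (pairB_mul_log_le hMr1).trans (by linarith)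
      calc (M : ℝ) * Real.log (2 * M) / T₀ ^ j = (M : ℝ) * Real.log (2 * M) * (1 / T₀ ^ j) := by ring
        _ ≤ 162 * T ^ 2 * ((2 : ℝ) ^ j * n ^ (-(η * j))) :=
            mul_le_mul h1 hT₀j (by positivity) (by positivity)
    -- (b) `(1+2T₀)^j/(n^j M^{j-2}) = M² ((1+2T₀)/(nM))^j ≤ 81 T² 3^j n^{-ηj}`
    have hnM : n ^ η * T₀ ≤ n * M := by
      calc n ^ η * T₀ = x * n := by rw [hx]; field_simp
        _ ≤ (M : ℝ) * n := mul_le_mul_of_nonneg_right hxM hn0.le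
        _ = n * M := mul_comm _ _
    have hratio : (1 + 2 * T₀) / (n * M) ≤ 3 * n ^ (-η) := by
      rw [div_le_iff₀ (by positivity)]
      have e : 3 * n ^ (-η) * (n ^ η * T₀) = 3 * T₀ := by
        rw [Real.rpow_neg hn0.le]; field_simp
      calc 1 + 2 * T₀ ≤ 3 * T₀ := by linarith
        _ = 3 * n ^ (-η) * (n ^ η * T₀) := e.symm
        _ ≤ 3 * n ^ (-η) * (n * M) := mul_le_mul_of_nonneg_left hnM (by positivity)
    have hb : (1 + 2 * T₀) ^ j / (n ^ j * (M : ℝ) ^ (j - 2)) ≤ 81 * T ^ 2 * ((3 : ℝ) ^ j * n ^ (-(η * j))) := by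
      have e1 : (1 + 2 * T₀) ^ j / (n ^ j * (M : ℝ) ^ (j - 2)) = (M : ℝ) ^ 2 * ((1 + 2 * T₀) / (n * M)) ^ j := by
        rw [div_pow, mul_pow]
        have : (M : ℝ) ^ j = (M : ℝ) ^ 2 * (M : ℝ) ^ (j - 2) := by rw [← pow_add]; congr 1; omega
        rw [this]; field_simp
      rw [e1]
      have h2 : ((1 + 2 * T₀) / (n * M)) ^ j ≤ (3 * n ^ (-η)) ^ j := pow_le_pow_left₀ (by positivity) hratio _
      have e2 : (3 * n ^ (-η)) ^ j = (3 : ℝ) ^ j * n ^ (-(η * j)) := by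
        rw [mul_pow, ← Real.rpow_natCast (n ^ (-η)) j, ← Real.rpow_mul hn0.le]; ring_nf
      calc (M : ℝ) ^ 2 * ((1 + 2 * T₀) / (n * M)) ^ j ≤ (81 * T ^ 2) * (3 * n ^ (-η)) ^ j :=
          mul_le_mul hM2 h2 (by positivity) (by positivity)
        _ = 81 * T ^ 2 * ((3 : ℝ) ^ j * n ^ (-(η * j))) := by rw [e2]
    have h23 : (2 : ℝ) ^ j ≤ 3 ^ j := pow_le_pow_left₀ (by norm_num) (by norm_num) j
    have hnj0 : 0 ≤ n ^ (-(η * j)) := by positivity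
    have hE : (M : ℝ) * Real.log (2 * M) / T₀ ^ j + (1 + 2 * T₀) ^ j / (n ^ j * (M : ℝ) ^ (j - 2)) ≤
        243 * 3 ^ j * (T ^ 2 * n ^ (-(η * j))) := by
      have : 162 * T ^ 2 * ((2 : ℝ) ^ j * n ^ (-(η * j))) ≤ 162 * T ^ 2 * ((3 : ℝ) ^ j * n ^ (-(η * j))) := by
        gcongr
      linarith [ha, hb, this]
    calc n * (CA * R ^ 2 * ((M : ℝ) * Real.log (2 * M) / T₀ ^ j + (1 + 2 * T₀) ^ j / (n ^ j * (M : ℝ) ^ (j - 2))))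
        ≤ n * (CA * R ^ 2 * (243 * 3 ^ j * (T ^ 2 * n ^ (-(η * j))))) := by
          refine mul_le_mul_of_nonneg_left (mul_le_mul_of_nonneg_left hE (by positivity)) hn0.le
      _ = 243 * 3 ^ j * CA * (n * R ^ 2 * T ^ 2 * n ^ (-(η * j))) := by ring

/-! ## §5. The pair-correlation sum: decomposition of the pairs and bookkeeping of the losses -/

section weight

variable {w : ℝ → ℝ}

set_option maxHeartbeats 4000000 in
/-- **Jutila 1977, §3 (case `q = 1`): the off-diagonal pair sum after the Halász–Montgomery step.**
For every smooth `w` supported in `[1,2]`, every `k ≥ 1`, `A ≥ 1` and `ε > 0` there are `C, N₀` such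
that for `N ≥ N₀`, `1 ≤ T ≤ N^A` and every `1`-separated `W` with pairwise differences `≤ T`,
`N ∑_{t≠t'∈W} |B_N(t−t')| ≤ C T^ε (|W| + N^{1/2}|W|^{2−1/k}(|W|((T/N)^k + (|W|T)^{1/2}))^{1/(2k)})`
— the bracket of the display after (3.2) on p. 60 of Jutila (the factor `G` being supplied by the
Halász–Montgomery inequality (3.1)). Proof: the pairs are split (`GuthMaynardS2.sum_pairs_le_classes`)
into `|t−t'| ≤ N^{1−η}` (negligible by Guth–Maynard's Lemma 4.3, `GuthMaynardFourier.norm_coefB_le`)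
and dyadic classes `|t−t'| ∼ T₀`, each bounded by `sum_class_le` (Guth–Maynard's Lemma 6.2 as the
reflection principle, Hölder with exponent `2k` over the pairs = (3.2), the `2k`-th moment of `D_M` by
Heath-Brown's theorem in place of Jutila's Lemma 3); `η = min(ε/5, 1/2)`, `j = ⌈(3A+2)/η⌉ + 2`.
[cite: Jutila1977, Section 3 display after (3.2)] -/
theorem sum_norm_coefB_pairs_le {w : ℝ → ℝ} (hw : ContDiff ℝ ∞ w)
    (hsupp : Function.support w ⊆ Set.Icc 1 2) {k : ℕ} (hk : 1 ≤ k) {A : ℝ} (hA : 1 ≤ A)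
    {ε : ℝ} (hε : 0 < ε) :
    ∃ C N₀ : ℝ, 0 ≤ C ∧ ∀ N : ℕ, N₀ ≤ (N : ℝ) → ∀ T : ℝ, 1 ≤ T → T ≤ (N : ℝ) ^ A →
      ∀ W : Finset ℝ, (∀ t ∈ W, ∀ t' ∈ W, |t - t'| ≤ T) →
      (∀ t ∈ W, ∀ t' ∈ W, t ≠ t' → 1 ≤ |t - t'|) →
      (N : ℝ) * ∑ t ∈ W, ∑ t' ∈ W, (if t ≠ t' then ‖GuthMaynardFourier.coefB w N (t - t')‖ else 0) ≤
        C * T ^ ε * ((W.card : ℝ) + (N : ℝ) ^ (1 / 2 : ℝ) * (W.card : ℝ) ^ (2 - 1 / (k : ℝ)) *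
          ((W.card : ℝ) * ((T / N) ^ k + ((W.card : ℝ) * T) ^ (1 / 2 : ℝ))) ^ (1 / (2 * (k : ℝ)))) := by
  classical
  have hk0 : (0 : ℝ) < k := by exact_mod_cast hk
  have hA0 : 0 < A := by linarith
  -- parameters
  set η : ℝ := min (ε / 5) (1 / 2) with hη
  have hη0 : 0 < η := lt_min (by positivity) (by norm_num)
  have hη1 : η ≤ 1 / 2 := min_le_right _ _
  have hηε : 5 * η ≤ ε := by have := min_le_left (ε / 5) (1 / 2); rw [← hη] at this; linarith
  have hηle1 : η ≤ 1 := by linarith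
  set j : ℕ := ⌈(3 * A + 2) / η⌉₊ + 2 with hj
  have hj2 : 2 ≤ j := by omega
  have hηj : 3 * A + 2 ≤ η * j := by
    have h1 : ((3 * A + 2) / η : ℝ) ≤ ⌈(3 * A + 2) / η⌉₊ := Nat.le_ceil _
    have h2 : ((⌈(3 * A + 2) / η⌉₊ : ℕ) : ℝ) ≤ j := by rw [hj]; push_cast; linarith
    calc (3 * A + 2 : ℝ) = η * ((3 * A + 2) / η) := by field_simp
      _ ≤ η * j := mul_le_mul_of_nonneg_left (h1.trans h2) hη0.le
  -- constants
  obtain ⟨CB, hCB0, hCB⟩ := norm_coefB_le hw hsupp hj2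
  obtain ⟨CA, hCA0, hCA⟩ := sum_norm_coefB_class_le hw hsupp hj2
  obtain ⟨CM, TM, hCM0, hCM⟩ := moment_dirD_le hk hη0
  set L : ℝ := ∫ ξ, ‖mel w ξ‖ with hL
  have hL0 : 0 ≤ L := integral_nonneg fun _ ↦ norm_nonneg _
  set Cη : ℝ := 1 / (η * Real.log 2) + 1 with hCη
  have hCη0 : 0 ≤ Cη := by positivity
  set cI : ℝ := Cη * 2 ^ η + 1 with hcI
  set cK : ℝ := Cη * 10 ^ η + 1 with hcK
  have hcI0 : 0 ≤ cI := by positivity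
  have hcK0 : 0 ≤ cK := by positivity
  set q : ℝ := ((2 * k : ℕ) : ℝ) with hq
  have hqk : q = 2 * (k : ℝ) := by rw [hq]; push_cast; ring
  have hq0 : 0 < q := by rw [hqk]; positivity
  set MC : ℝ := 48 * Real.sqrt 6 * L * (3 * 9 ^ k * CM) ^ (1 / q) with hMC
  have hMC0 : 0 ≤ MC := by positivity
  set Tmin : ℝ := max TM 9 with hTmin
  have hTmin9 : 9 ≤ Tmin := le_max_right _ _
  have hTminM : TM ≤ Tmin := le_max_left _ _
  set N₀ : ℝ := max (max (2 * CB * 2 ^ j) (486 * 3 ^ j * CA)) (max (64 * Tmin ^ 2) 1) with hN₀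
  refine ⟨1 + cI + 64 * MC * cK * cI, N₀, by positivity, fun N hN T hT1 hTA W hdiam hsep ↦ ?_⟩
  -- basic quantities
  set n : ℝ := (N : ℝ) with hn
  have hN1 : (1 : ℝ) ≤ n := le_trans ((le_max_right _ _).trans (le_max_right _ _)) hN
  have hNCB : 2 * CB * 2 ^ j ≤ n := le_trans ((le_max_left _ _).trans (le_max_left _ _)) hN
  have hNCA : 486 * 3 ^ j * CA ≤ n := le_trans ((le_max_right _ _).trans (le_max_left _ _)) hN
  have hNT : 64 * Tmin ^ 2 ≤ n := le_trans ((le_max_left _ _).trans (le_max_right _ _)) hN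
  have hn0 : 0 < n := by linarith
  have hT0 : 0 < T := by linarith
  have hTε : 1 ≤ T ^ ε := Real.one_le_rpow hT1 hε.le
  set R : ℝ := (W.card : ℝ) with hR
  have hR0 : 0 ≤ R := Nat.cast_nonneg _
  set MAIN : ℝ := n ^ (1 / 2 : ℝ) * R ^ (2 - 1 / (k : ℝ)) *
    (R * ((T / n) ^ k + (R * T) ^ (1 / 2 : ℝ))) ^ (1 / (2 * (k : ℝ))) with hMAIN
  have hMAIN0 : 0 ≤ MAIN := by positivity
  -- the empty set
  rcases W.eq_empty_or_nonempty with hWe | hWne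
  · have : ∑ t ∈ W, ∑ t' ∈ W, (if t ≠ t' then ‖coefB w n (t - t')‖ else 0) = 0 := by rw [hWe]; simp
    rw [this, mul_zero]
    positivity
  -- the window form of the hypotheses
  set t₀ : ℝ := W.min' hWne with ht₀
  have hwin : ∀ t ∈ W, t₀ ≤ t ∧ t ≤ t₀ + T := by
    intro t ht
    have h1 : t₀ ≤ t := Finset.min'_le W t ht
    have h2 := hdiam t ht t₀ (Finset.min'_mem W hWne)
    rw [abs_le] at h2
    exact ⟨h1, by linarith [h2.2]⟩
  have hRT1 : R ≤ T + 1 := card_le_of_window hT0.le hwin hsep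
  have hRT : R ≤ 2 * T := by linarith
  have hRnA : R ≤ 2 * n ^ A := hRT.trans (by linarith)
  -- Step 1: the sum as `∑ f(t − t')` and the decomposition of the pairs
  set f : ℝ → ℝ := fun τ ↦ if τ = 0 then 0 else n * ‖coefB w n τ‖ with hf
  have hf0 : ∀ τ, 0 ≤ f τ := fun τ ↦ by simp only [hf]; split_ifs <;> positivity
  have hLHS : n * ∑ t ∈ W, ∑ t' ∈ W, (if t ≠ t' then ‖coefB w n (t - t')‖ else 0) =
      ∑ t ∈ W, ∑ t' ∈ W, f (t - t') := by
    rw [Finset.mul_sum]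
    refine Finset.sum_congr rfl fun t _ ↦ ?_
    rw [Finset.mul_sum]
    refine Finset.sum_congr rfl fun t' _ ↦ ?_
    simp only [hf, sub_eq_zero]
    by_cases h : t = t'
    · simp [h]
    · simp [h]
  rw [hLHS]
  set Θ : ℝ := n ^ (1 - η) with hΘ
  have hΘ1 : 1 ≤ Θ := Real.one_le_rpow hN1 (by linarith)
  set I : ℕ := Nat.log 2 ⌈T⌉₊ + 1 with hI
  have hTceil : 1 ≤ ⌈T⌉₊ := Nat.one_le_iff_ne_zero.mpr (Nat.pos_iff_ne_zero.mp (Nat.ceil_pos.mpr hT0))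
  have hTI : T ≤ 2 ^ I := by
    have h1 : (⌈T⌉₊ : ℝ) < 2 ^ (Nat.log 2 ⌈T⌉₊ + 1) := by
      exact_mod_cast Nat.lt_pow_succ_log_self one_lt_two ⌈T⌉₊
    exact (Nat.le_ceil T).trans h1.le
  have hclasses := sum_pairs_le_classes f hf0 W hΘ1 hTI hdiam
  set Igood := (Finset.range (I + 1)).filter (fun i ↦ Θ < (2 : ℝ) ^ (i + 1)) with hIgood
  have hf00 : f 0 = 0 := by simp [hf]
  -- the number of classes
  have hIcard : (Igood.card : ℝ) ≤ cI * T ^ η := by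
    have h1 : (Igood.card : ℝ) ≤ I + 1 := by
      have : Igood.card ≤ (Finset.range (I + 1)).card := Finset.card_filter_le _ _
      rw [Finset.card_range] at this
      exact_mod_cast this
    have h2 : ((Nat.log 2 ⌈T⌉₊ : ℕ) : ℝ) + 1 ≤ Cη * (⌈T⌉₊ : ℝ) ^ η := natLog_add_one_le hη0 hTceil
    have h3 : (⌈T⌉₊ : ℝ) ≤ 2 * T := by linarith [Nat.ceil_lt_add_one hT0.le]
    have h4 : (⌈T⌉₊ : ℝ) ^ η ≤ 2 ^ η * T ^ η := by
      rw [← Real.mul_rpow zero_le_two hT0.le]; exact Real.rpow_le_rpow (Nat.cast_nonneg _) h3 hη0.le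
    have h5 : (1 : ℝ) ≤ T ^ η := Real.one_le_rpow hT1 hη0.le
    calc (Igood.card : ℝ) ≤ I + 1 := h1
      _ = (((Nat.log 2 ⌈T⌉₊ : ℕ) : ℝ) + 1) + 1 := by rw [hI]; push_cast; ring
      _ ≤ Cη * (2 ^ η * T ^ η) + T ^ η := add_le_add (h2.trans (mul_le_mul_of_nonneg_left h4 hCη0)) h5
      _ = cI * T ^ η := by rw [hcI]; ring
  -- Step 2: the small differences are negligible
  have hsmall : ∑ t ∈ W, ∑ t' ∈ W, (if t ≠ t' ∧ |t - t'| ≤ Θ then f (t - t') else 0) ≤ R := by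
    have hterm : ∀ t ∈ W, ∀ t' ∈ W, (if t ≠ t' ∧ |t - t'| ≤ Θ then f (t - t') else 0) ≤
        CB * 2 ^ j * (n * n ^ (-(η * j))) := by
      intro t _ t' _
      split_ifs with h
      · have hne : t - t' ≠ 0 := sub_ne_zero.mpr h.1
        simp only [hf, hne, if_false]
        have h1 := hCB (t - t') n hN1
        have h2 : (1 + |t - t'|) ^ j ≤ (2 * Θ) ^ j := pow_le_pow_left₀ (by positivity) (by linarith [h.2]) j
        have e3 : (2 * Θ) ^ j / n ^ j = 2 ^ j * n ^ (-(η * j)) := by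
          rw [mul_pow, hΘ, ← Real.rpow_natCast (n ^ (1 - η)) j, ← Real.rpow_mul hn0.le,
            ← Real.rpow_natCast n j, mul_div_assoc, ← Real.rpow_sub hn0]
          congr 1; ring_nf
        calc n * ‖coefB w n (t - t')‖ ≤ n * (CB * (1 + |t - t'|) ^ j / n ^ j) :=
              mul_le_mul_of_nonneg_left h1 hn0.le
          _ ≤ n * (CB * (2 * Θ) ^ j / n ^ j) := by gcongr
          _ = CB * 2 ^ j * (n * n ^ (-(η * j))) := by rw [mul_div_assoc, e3]; ring
      · positivity
    have hneg : CB * 2 ^ j * (n * n ^ (-(η * j))) * R ≤ 1 := by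
      -- `CB 2^j n^{1−ηj} · 2n^A ≤ 1` since `ηj ≥ 3A+2` and `n ≥ 2 CB 2^j`
      have h1 : n * n ^ (-(η * j)) * (2 * n ^ A) = 2 * n ^ (1 + A - η * j) := by
        rw [show 1 + A - η * j = 1 + (-(η * j)) + A by ring, Real.rpow_add hn0, Real.rpow_add hn0,
          Real.rpow_one]; ring
      have h2 : n ^ (1 + A - η * j) ≤ n ^ (-1 : ℝ) := Real.rpow_le_rpow_of_exponent_le hN1 (by linarith)
      have h3 : n ^ (-1 : ℝ) = 1 / n := by rw [Real.rpow_neg_one, one_div]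
      calc CB * 2 ^ j * (n * n ^ (-(η * j))) * R ≤ CB * 2 ^ j * (n * n ^ (-(η * j))) * (2 * n ^ A) := by
            gcongr
        _ = CB * 2 ^ j * (2 * n ^ (1 + A - η * j)) := by rw [mul_assoc (CB * 2 ^ j), h1]
        _ ≤ CB * 2 ^ j * (2 * (1 / n)) := by rw [← h3]; gcongr
        _ = (2 * CB * 2 ^ j) / n := by ring
        _ ≤ 1 := by rw [div_le_one hn0]; exact hNCB
    calc ∑ t ∈ W, ∑ t' ∈ W, (if t ≠ t' ∧ |t - t'| ≤ Θ then f (t - t') else 0)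
        ≤ ∑ t ∈ W, ∑ t' ∈ W, CB * 2 ^ j * (n * n ^ (-(η * j))) :=
          Finset.sum_le_sum fun t ht ↦ Finset.sum_le_sum fun t' ht' ↦ hterm t ht t' ht'
      _ = (CB * 2 ^ j * (n * n ^ (-(η * j))) * R) * R := by
          simp only [Finset.sum_const, nsmul_eq_mul, hR]; ring
      _ ≤ 1 * R := mul_le_mul_of_nonneg_right hneg hR0
      _ = R := one_mul R
  -- Step 3: the dyadic classes
  set Mmax : ℕ := ⌈9 * n ^ η * T / n⌉₊ with hMmax
  set K : ℕ := Nat.log 2 Mmax + 2 with hK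
  have hnηpos : 0 < n ^ η := Real.rpow_pos_of_pos hn0 η
  have hnη : n ^ η ≤ n := by
    conv_rhs => rw [← Real.rpow_one n]
    exact Real.rpow_le_rpow_of_exponent_le hN1 hηle1
  have hMmax1 : 1 ≤ Mmax := by
    rw [hMmax]; refine Nat.one_le_iff_ne_zero.mpr (Nat.pos_iff_ne_zero.mp (Nat.ceil_pos.mpr ?_))
    have h9 : 9 * n ^ η * T / n = 9 * n ^ η * (T / n) := by ring
    rw [h9]; exact mul_pos (by positivity) (div_pos hT0 hn0)
  have hMmaxle : 9 * n ^ η * T / n ≤ (Mmax : ℝ) := Nat.le_ceil _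
  have hK2 : ∀ M : ℕ, M ≤ Mmax → 2 * (M : ℝ) ≤ 2 ^ K := by
    intro M hM
    have h1 : (Mmax : ℝ) < 2 ^ (Nat.log 2 Mmax + 1) := by exact_mod_cast Nat.lt_pow_succ_log_self one_lt_two Mmax
    have h2 : (M : ℝ) ≤ Mmax := by exact_mod_cast hM
    rw [hK, show Nat.log 2 Mmax + 2 = (Nat.log 2 Mmax + 1) + 1 by ring, pow_succ]
    linarith
  have hKbound : (K : ℝ) ≤ cK * T ^ η := by
    have h2 : ((Nat.log 2 Mmax : ℕ) : ℝ) + 1 ≤ Cη * (Mmax : ℝ) ^ η := natLog_add_one_le hη0 hMmax1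
    have h3 : (Mmax : ℝ) ≤ 10 * T := by
      have h4 : 9 * n ^ η * T / n ≤ 9 * T := by
        rw [div_le_iff₀ hn0]
        calc 9 * n ^ η * T = 9 * (n ^ η * T) := by ring
          _ ≤ 9 * (n * T) := by gcongr
          _ = 9 * T * n := by ring
      have := Nat.ceil_lt_add_one (show (0 : ℝ) ≤ 9 * n ^ η * T / n by positivity)
      rw [hMmax]; linarith
    have h4 : (Mmax : ℝ) ^ η ≤ 10 ^ η * T ^ η := by
      rw [← Real.mul_rpow (by norm_num) hT0.le]; exact Real.rpow_le_rpow (Nat.cast_nonneg _) h3 hη0.le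
    have h5 : (1 : ℝ) ≤ T ^ η := Real.one_le_rpow hT1 hη0.le
    calc (K : ℝ) = (((Nat.log 2 Mmax : ℕ) : ℝ) + 1) + 1 := by rw [hK]; push_cast; ring
      _ ≤ Cη * (10 ^ η * T ^ η) + T ^ η := add_le_add (h2.trans (mul_le_mul_of_nonneg_left h4 hCη0)) h5
      _ = cK * T ^ η := by rw [hcK]; ring
  -- each good class
  have hclass : ∀ i ∈ Igood, ∑ t ∈ W, ∑ t' ∈ W,
      (if (2 : ℝ) ^ i ≤ |t - t'| ∧ |t - t'| ≤ 2 * 2 ^ i then f (t - t') else 0) ≤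
        64 * MC * cK * T ^ (4 * η) * MAIN + R := by
    intro i hi
    rw [hIgood, Finset.mem_filter, Finset.mem_range] at hi
    obtain ⟨hiI, hiΘ⟩ := hi
    -- a class exists, so `T` is large: `n^{1/2} ≤ n^{1−η} < 2^{i+1} ≤ 4⌈T⌉ ≤ 8T`
    have h2I : (2 : ℝ) ^ (i + 1) ≤ 8 * T := by
      have h1 : (2 : ℝ) ^ (i + 1) ≤ 2 ^ (I + 1) := pow_le_pow_right₀ one_le_two (by omega)
      have h2 : (2 : ℝ) ^ (I + 1) ≤ 4 * ⌈T⌉₊ := by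
        rw [hI, pow_succ, pow_succ]
        have : ((2 ^ Nat.log 2 ⌈T⌉₊ : ℕ) : ℝ) ≤ ⌈T⌉₊ := by
          exact_mod_cast Nat.pow_log_le_self 2 (by omega)
        push_cast at this; linarith
      have h3 : (⌈T⌉₊ : ℝ) ≤ T + 1 := (Nat.ceil_lt_add_one hT0.le).le
      linarith
    have hn12 : n ^ (1 / 2 : ℝ) ≤ Θ := Real.rpow_le_rpow_of_exponent_le hN1 (by linarith)
    have hT9' : Tmin < T := by
      -- `8 Tmin ≤ n^{1/2}` from `n ≥ 64 Tmin²`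
      have h1 : (8 * Tmin) ^ 2 ≤ n := by nlinarith
      have h2 : 8 * Tmin ≤ n ^ (1 / 2 : ℝ) := by
        have h3 : ((8 * Tmin) ^ 2) ^ (1 / 2 : ℝ) ≤ n ^ (1 / 2 : ℝ) :=
          Real.rpow_le_rpow (by positivity) h1 (by norm_num)
        have h4 : ((8 * Tmin) ^ 2) ^ (1 / 2 : ℝ) = 8 * Tmin := by
          rw [← Real.sqrt_eq_rpow, Real.sqrt_sq (by positivity)]
        rwa [h4] at h3
      have h5 : 8 * Tmin < 8 * T := by linarith [h2, hn12, hiΘ, h2I]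
      linarith
    have hT9 : 9 ≤ T := by linarith
    have hTM : TM ≤ T := by linarith
    have hiT : (2 : ℝ) ^ i ≤ 3 * T := by
      have h1 : (2 : ℝ) ^ i ≤ 2 ^ I := pow_le_pow_right₀ one_le_two (Nat.lt_succ_iff.mp hiI)
      have h2 : (2 : ℝ) ^ I ≤ 2 * ⌈T⌉₊ := by
        rw [hI, pow_succ']
        have : ((2 ^ Nat.log 2 ⌈T⌉₊ : ℕ) : ℝ) ≤ ⌈T⌉₊ := by
          exact_mod_cast Nat.pow_log_le_self 2 (by omega)
        push_cast at this; linarith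
      have h3 : (⌈T⌉₊ : ℝ) ≤ T + 1 := (Nat.ceil_lt_add_one hT0.le).le
      linarith
    -- the class bound
    have hcl := sum_class_le w hk hCA0 hCM0 hL0 hN1 hT9 hη0 hη1 hj2 W hRT hMmaxle hK2
      (fun M K' hM hMK T₀ hT₀ Φ hΦ ↦ hCA n hN1 M K' hM hMK T₀ hT₀ W Φ hΦ)
      (fun M hM hMT2 ξ ↦ hCM T hTM M hM hMT2 W t₀ hwin hsep ξ) hiΘ hiT
    -- `f` on the class: `|t − t'| ≥ 2^i ≥ 1`, so `t ≠ t'`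
    have hfe : ∑ t ∈ W, ∑ t' ∈ W,
        (if (2 : ℝ) ^ i ≤ |t - t'| ∧ |t - t'| ≤ 2 * 2 ^ i then f (t - t') else 0) =
        ∑ t ∈ W, ∑ t' ∈ W,
        (if (2 : ℝ) ^ i ≤ |t - t'| ∧ |t - t'| ≤ 2 * 2 ^ i then n * ‖coefB w n (t - t')‖ else 0) := by
      refine Finset.sum_congr rfl fun t _ ↦ Finset.sum_congr rfl fun t' _ ↦ ?_
      split_ifs with h
      · have hne : t - t' ≠ 0 := by
          intro h0
          have : (1 : ℝ) ≤ 2 ^ i := one_le_pow₀ one_le_two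
          rw [h0, abs_zero] at h
          linarith [h.1]
        simp [hf, hne]
      · rfl
    rw [hfe]
    refine hcl.trans (add_le_add ?_ ?_)
    · -- the main part: `K ≤ cK T^η`, `T^{η/q} ≤ T^η`, `n^η ≤ 64 T^{2η}`
      have hnη64 : n ^ η ≤ 64 * T ^ (2 * η) := by
        have h1 : n ^ (1 / 2 : ℝ) ≤ 8 * T := by linarith [hn12, hiΘ, h2I]
        have h2 : n ≤ (8 * T) ^ 2 := by
          have h3 : (n ^ (1 / 2 : ℝ)) ^ 2 ≤ (8 * T) ^ 2 := pow_le_pow_left₀ (by positivity) h1 2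
          rwa [← Real.rpow_natCast (n ^ (1 / 2 : ℝ)) 2, ← Real.rpow_mul hn0.le,
            show (1 / 2 : ℝ) * (2 : ℕ) = 1 by norm_num, Real.rpow_one] at h3
        calc n ^ η ≤ ((8 * T) ^ 2) ^ η := Real.rpow_le_rpow hn0.le h2 hη0.le
          _ = 64 ^ η * T ^ (2 * η) := by
              rw [show (8 * T) ^ 2 = 64 * T ^ 2 by ring, Real.mul_rpow (by norm_num) (by positivity),
                ← Real.rpow_natCast T 2, ← Real.rpow_mul hT0.le]; norm_num
          _ ≤ 64 * T ^ (2 * η) := by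
              refine mul_le_mul_of_nonneg_right ?_ (by positivity)
              calc (64 : ℝ) ^ η ≤ 64 ^ (1 : ℝ) := Real.rpow_le_rpow_of_exponent_le (by norm_num) hηle1
                _ = 64 := Real.rpow_one _
      have hTq : T ^ (η / q) ≤ T ^ η := by
        refine Real.rpow_le_rpow_of_exponent_le hT1 ?_
        have hk1 : (1 : ℝ) ≤ k := by exact_mod_cast hk
        rw [div_le_iff₀ hq0, hqk]; nlinarith [hη0, hk1]
      have hexp : (K : ℝ) * T ^ (η / q) * n ^ η ≤ 64 * cK * T ^ (4 * η) := by
        calc (K : ℝ) * T ^ (η / q) * n ^ η ≤ (cK * T ^ η) * T ^ η * (64 * T ^ (2 * η)) := by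
              gcongr
          _ = 64 * cK * (T ^ η * T ^ η * T ^ (2 * η)) := by ring
          _ = 64 * cK * T ^ (4 * η) := by
              rw [← Real.rpow_add hT0, ← Real.rpow_add hT0]; ring_nf
      have hMAINq : n ^ (1 / 2 : ℝ) * R ^ (2 - 1 / (k : ℝ)) *
          (R * ((T / n) ^ k + (R * T) ^ (1 / 2 : ℝ))) ^ (1 / q) = MAIN := by
        rw [hMAIN, hqk]
      calc 48 * Real.sqrt 6 * L * (3 * 9 ^ k * CM) ^ (1 / q) * K * T ^ (η / q) * n ^ η *
            (n ^ (1 / 2 : ℝ) * R ^ (2 - 1 / (k : ℝ)) * (R * ((T / n) ^ k + (R * T) ^ (1 / 2 : ℝ))) ^ (1 / q))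
          = MC * ((K : ℝ) * T ^ (η / q) * n ^ η) * MAIN := by rw [hMAINq, hMC]; ring
        _ ≤ MC * (64 * cK * T ^ (4 * η)) * MAIN :=
            mul_le_mul_of_nonneg_right (mul_le_mul_of_nonneg_left hexp hMC0) hMAIN0
        _ = 64 * MC * cK * T ^ (4 * η) * MAIN := by ring
    · -- the negligible part: `243·3^j CA · n R² T² n^{−ηj} ≤ R`
      have h1 : n * R ^ 2 * T ^ 2 * n ^ (-(η * j)) ≤ R * (2 * n ^ (1 + 3 * A - η * j)) := by
        have hT2 : T ^ 2 ≤ n ^ (2 * A) := by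
          calc T ^ 2 ≤ (n ^ A) ^ 2 := pow_le_pow_left₀ hT0.le hTA 2
            _ = n ^ (2 * A) := by rw [← Real.rpow_natCast (n ^ A) 2, ← Real.rpow_mul hn0.le]; ring_nf
        have e : n * (2 * n ^ A) * n ^ (2 * A) * n ^ (-(η * j)) = 2 * n ^ (1 + 3 * A - η * j) := by
          rw [show 1 + 3 * A - η * j = 1 + A + 2 * A + (-(η * j)) by ring, Real.rpow_add hn0,
            Real.rpow_add hn0, Real.rpow_add hn0, Real.rpow_one]; ring
        calc n * R ^ 2 * T ^ 2 * n ^ (-(η * j)) = R * (n * R * T ^ 2 * n ^ (-(η * j))) := by ring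
          _ ≤ R * (n * (2 * n ^ A) * n ^ (2 * A) * n ^ (-(η * j))) := by
              refine mul_le_mul_of_nonneg_left ?_ hR0
              gcongr
          _ = R * (2 * n ^ (1 + 3 * A - η * j)) := by rw [e]
      have h2 : n ^ (1 + 3 * A - η * j) ≤ n ^ (-1 : ℝ) := Real.rpow_le_rpow_of_exponent_le hN1 (by linarith)
      have h3 : n ^ (-1 : ℝ) = 1 / n := by rw [Real.rpow_neg_one, one_div]
      calc 243 * 3 ^ j * CA * (n * R ^ 2 * T ^ 2 * n ^ (-(η * j)))
          ≤ 243 * 3 ^ j * CA * (R * (2 * n ^ (1 + 3 * A - η * j))) := by gcongr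
        _ ≤ 243 * 3 ^ j * CA * (R * (2 * (1 / n))) := by rw [← h3]; gcongr
        _ = R * ((486 * 3 ^ j * CA) / n) := by ring
        _ ≤ R * 1 := by
            refine mul_le_mul_of_nonneg_left ?_ hR0
            rw [div_le_one hn0]; exact hNCA
        _ = R := mul_one R
  have hPclasses : ∑ i ∈ Igood, ∑ t ∈ W, ∑ t' ∈ W,
      (if (2 : ℝ) ^ i ≤ |t - t'| ∧ |t - t'| ≤ 2 * 2 ^ i then f (t - t') else 0) ≤
        cI * T ^ η * (64 * MC * cK * T ^ (4 * η) * MAIN + R) := by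
    calc _ ≤ ∑ i ∈ Igood, (64 * MC * cK * T ^ (4 * η) * MAIN + R) := Finset.sum_le_sum hclass
      _ = Igood.card * (64 * MC * cK * T ^ (4 * η) * MAIN + R) := by rw [Finset.sum_const, nsmul_eq_mul]
      _ ≤ cI * T ^ η * (64 * MC * cK * T ^ (4 * η) * MAIN + R) :=
          mul_le_mul_of_nonneg_right hIcard (by positivity)
  -- Step 4: collect
  have hT5 : T ^ η * T ^ (4 * η) ≤ T ^ ε := by
    rw [← Real.rpow_add hT0]
    exact Real.rpow_le_rpow_of_exponent_le hT1 (by linarith)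
  have hTη : T ^ η ≤ T ^ ε := Real.rpow_le_rpow_of_exponent_le hT1 (by linarith)
  calc ∑ t ∈ W, ∑ t' ∈ W, f (t - t')
      ≤ W.card * f 0 + ∑ t ∈ W, ∑ t' ∈ W, (if t ≠ t' ∧ |t - t'| ≤ Θ then f (t - t') else 0) +
        ∑ i ∈ Igood, ∑ t ∈ W, ∑ t' ∈ W,
          (if (2 : ℝ) ^ i ≤ |t - t'| ∧ |t - t'| ≤ 2 * 2 ^ i then f (t - t') else 0) := hclasses
    _ ≤ 0 + R + cI * T ^ η * (64 * MC * cK * T ^ (4 * η) * MAIN + R) := by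
        rw [hf00, mul_zero]
        exact add_le_add (add_le_add le_rfl hsmall) hPclasses
    _ = R + cI * (T ^ η * R) + 64 * MC * cK * cI * (T ^ η * T ^ (4 * η)) * MAIN := by ring
    _ ≤ T ^ ε * R + cI * (T ^ ε * R) + 64 * MC * cK * cI * T ^ ε * MAIN := by
        have a1 : R ≤ T ^ ε * R := le_mul_of_one_le_left hR0 hTε
        have a2 : cI * (T ^ η * R) ≤ cI * (T ^ ε * R) :=
          mul_le_mul_of_nonneg_left (mul_le_mul_of_nonneg_right hTη hR0) hcI0
        have a3 : 64 * MC * cK * cI * (T ^ η * T ^ (4 * η)) * MAIN ≤ 64 * MC * cK * cI * T ^ ε * MAIN :=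
          mul_le_mul_of_nonneg_right (mul_le_mul_of_nonneg_left hT5 (by positivity)) hMAIN0
        linarith
    _ ≤ (1 + cI + 64 * MC * cK * cI) * T ^ ε * (R + MAIN) := by
        have e : (1 + cI + 64 * MC * cK * cI) * T ^ ε * (R + MAIN) =
            (T ^ ε * R + cI * (T ^ ε * R) + 64 * MC * cK * cI * T ^ ε * MAIN) +
            (T ^ ε * MAIN + cI * (T ^ ε * MAIN) + 64 * MC * cK * cI * (T ^ ε * R)) := by ring
        have hpos : 0 ≤ T ^ ε * MAIN + cI * (T ^ ε * MAIN) + 64 * MC * cK * cI * (T ^ ε * R) := by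
          positivity
        rw [e]; linarith

end weight

end Jutila1977

end Literature.NumberTheory.LFunctions

end
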